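import Literature.MathematicalPhysics.KineticTheory.DiPernaLionsGainLevelTruncation
import Literature.MathematicalPhysics.KineticTheory.DiPernaLionsExpDuhamel
import Literature.MathematicalPhysics.KineticTheory.DiPernaLionsDampingLimit
import Literature.MathematicalPhysics.KineticTheory.DiPernaLionsLimitEntropy
import Literature.MathematicalPhysics.KineticTheory.DiPernaLionsCollisionTermsProofs
import Literature.MathematicalPhysics.KineticTheory.DiPernaLionsGainUpperBound
import HarnessLib

/-!
# The DiPerna–Lions weak limit is an exponential subsolution (CIP 1994 Lemma 5.3.12, second half)

Topic: MathematicalPhysics / KineticTheory. Infrastructure for the named fact (L12)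
`diPernaLions_limit_expDuhamel` (Cercignani–Illner–Pulvirenti 1994 §5.3 Lemma 5.3.12): the
**subsolution half** `f ≤ f₀ e^{-F} + T_F⁻¹ Q₊(f,f)` (display before (3.44), p. 159), i.e. the
hypothesis `hsub` of the proved conditional assembly `diPernaLions_limit_expDuhamel_of`
(`DiPernaLionsExpDuhamel`): `IsDiPernaLionsWeakLimit.isExpSubsolution`. Everything in this file is
proved; two definitions with bodies (`levelWeight`, `duhamelMultiplier`), no named fact.

CIP's printed route ((3.41)–(3.43): the renormalisations `hₘⁿ = m ln(1 + fⁿ/m)` and Lemma 5.3.11 iii))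
uses the additional assumption (3.13) `A ∈ L^∞_loc`. In the tree's DiPerna–Lions generality the
proof runs instead through

* the exponential form (3.36) of `f^{φ(k)}` along characteristics with the **level truncation** of its
  Duhamel gain term (`DiPernaLionsGainLevelTruncation`: off the exceptional set
  `{e^{Λₖ♯(t)} f^{φ(k)}♯(t) > M}` the gain term only sees `f^{φ(k)} ≤ M`, where it is equi-integrable by
  Lemma 5.3.7), integrated over a set `C` of characteristics of finite measure;
* the **upper semicontinuity of the renormalised gain terms** along the sequence
  (`DiPernaLionsGainUpperBound`, velocity averaging), applied with the level weights
  `wₖ = 1_{f^{φ(k)} ≤ M}` and the sheared Duhamel multiplier of the limit damping `F`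
  (`duhamelMultiplier`; Tonelli and the free-streaming shear turn `∫_C (T_Λ⁻¹ ·)♯(t)` into a pairing on
  phase space-time, `setLIntegral_levelCut_eq_lintegral`, `lintegral_duhamelMultiplier_eGain_le`);
* the convergence `Λₖ♯ → F♯` of the damping exponents in `L¹` (`DiPernaLionsDampingLimit`, CIP Step 13
  and Lemma 5.3.11 ii)), which controls the multiplier error (`eventually_lintegral_levelCut_diff_le`),
  the data term `f^{φ(k)}(0) e^{-Λₖ♯(t)} → f(0) e^{-F♯(t)}` (`eventually_setLIntegral_data_le`) and the
  exceptional set (`exists_level_eventually_setLIntegral_exceptional_le`, with the equi-integrability of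
  the slices from the entropy bound (3.21));
* the weak convergence of the slices, `∫_C f^{φ(k)}♯(t) → ∫_C f♯(t)` (`tendsto_setLIntegral_sharp`).

The resulting inequality on sets (`IsDiPernaLionsWeakLimit.setLIntegral_sharp_le`) gives the a.e.
inequality `IsExpSubsolution B f` (`ae_le_of_forall_setLIntegral_le_of_sigmaFinite` on `E × B̄_n`).

## References

* C. Cercignani, R. Illner, M. Pulvirenti, *The Mathematical Theory of Dilute Gases*, Springer
  (1994), §5.3 Step 8 (3.25)–(3.26) (p. 147), Lemma 5.3.7 (p. 148), Lemma 5.3.11 (pp. 155–156),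
  Step 13 (3.36) (p. 157), Lemma 5.3.12 and its proof (pp. 157–159).
* R. J. DiPerna, P.-L. Lions, *On the Cauchy problem for Boltzmann equations: global existence and
  weak stability*, Ann. of Math. 130 (1989) 321–366.
-/

open MeasureTheory Metric Real Set Filter Topology
open scoped InnerProductSpace ENNReal

noncomputable section

namespace Literature.MathematicalPhysics.KineticTheory

open Literature.Analysis.FluidPDE Literature.Analysis.FunctionSpaces

section Elementary

variable {E : Type*} [NormedAddCommGroup E] [InnerProductSpace ℝ E] [FiniteDimensional ℝ E]
  [MeasurableSpace E] [BorelSpace E]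

/-- **Equi-integrability from the entropy bound** (the elementary half of de la Vallée-Poussin,
CIP 1994 §5.3 Step 8 (3.25)/(3.26), p. 147): if `u ≥ 0` has
`∫∫ u (1 + |x|² + |v|² + |log u|) ≤ C` then for `R > 1` and every measurable set `S`,
`∫_S u ≤ R |S| + C / log R` (on `{u > R}`, `u ≤ u log u / log R`). [cite: CIPDiluteGases1994, §5.3 Step 8 (3.25)–(3.26) (p. 147)] -/
theorem setLIntegral_le_of_massEntropy_le {u : E × E → ℝ} (hum : Measurable u)
    {C : ℝ} (hC : ∫⁻ z, ENNReal.ofReal (u z * (1 + ‖z.1‖ ^ 2 + ‖z.2‖ ^ 2 + |log (u z)|))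
      ∂((volume : Measure E).prod volume) ≤ ENNReal.ofReal C)
    {R : ℝ} (hR : 1 < R) (S : Set (E × E)) :
    ∫⁻ z in S, ENNReal.ofReal (u z) ∂((volume : Measure E).prod volume) ≤
      ENNReal.ofReal R * ((volume : Measure E).prod volume) S + ENNReal.ofReal (C / log R) := by
  have hlogR : 0 < log R := log_pos hR
  -- pointwise bound
  have hpt : ∀ z, ENNReal.ofReal (u z) ≤ ENNReal.ofReal R +
      ENNReal.ofReal ((log R)⁻¹ * (u z * (1 + ‖z.1‖ ^ 2 + ‖z.2‖ ^ 2 + |log (u z)|))) := by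
    intro z
    by_cases huz : u z ≤ R
    · exact (ENNReal.ofReal_le_ofReal huz).trans le_self_add
    · rw [not_le] at huz
      refine le_add_left (ENNReal.ofReal_le_ofReal ?_)
      have hupos : 0 < u z := lt_trans (lt_trans zero_lt_one hR) huz
      have hlog : log R ≤ log (u z) := log_le_log (lt_trans zero_lt_one hR) huz.le
      have hlog0 : 0 < log (u z) := hlogR.trans_le hlog
      rw [abs_of_pos hlog0]
      have h1 : u z * log R ≤ u z * (1 + ‖z.1‖ ^ 2 + ‖z.2‖ ^ 2 + log (u z)) := by
        refine mul_le_mul_of_nonneg_left ?_ hupos.le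
        nlinarith [sq_nonneg ‖z.1‖, sq_nonneg ‖z.2‖]
      rw [inv_mul_eq_div, le_div_iff₀ hlogR]
      exact h1
  have hm : Measurable fun z : E × E => ENNReal.ofReal ((log R)⁻¹ * (u z * (1 + ‖z.1‖ ^ 2 + ‖z.2‖ ^ 2 + |log (u z)|))) :=
    (measurable_const.mul ((hum.mul ((measurable_const.add (measurable_fst.norm.pow_const 2)).add
      (measurable_snd.norm.pow_const 2) |>.add hum.log.abs)))).ennreal_ofReal
  calc ∫⁻ z in S, ENNReal.ofReal (u z) ∂((volume : Measure E).prod volume)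
      ≤ ∫⁻ z in S, (ENNReal.ofReal R + ENNReal.ofReal ((log R)⁻¹ * (u z * (1 + ‖z.1‖ ^ 2 + ‖z.2‖ ^ 2 + |log (u z)|))))
          ∂((volume : Measure E).prod volume) := lintegral_mono fun z => hpt z
    _ = ENNReal.ofReal R * ((volume : Measure E).prod volume) S +
          ∫⁻ z in S, ENNReal.ofReal ((log R)⁻¹ * (u z * (1 + ‖z.1‖ ^ 2 + ‖z.2‖ ^ 2 + |log (u z)|)))
            ∂((volume : Measure E).prod volume) := by
        rw [lintegral_add_right _ hm, setLIntegral_const, mul_comm]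
    _ ≤ ENNReal.ofReal R * ((volume : Measure E).prod volume) S +
          ∫⁻ z, ENNReal.ofReal ((log R)⁻¹ * (u z * (1 + ‖z.1‖ ^ 2 + ‖z.2‖ ^ 2 + |log (u z)|)))
            ∂((volume : Measure E).prod volume) :=
        add_le_add le_rfl (lintegral_mono' Measure.restrict_le_self le_rfl)
    _ ≤ ENNReal.ofReal R * ((volume : Measure E).prod volume) S + ENNReal.ofReal (C / log R) := by
        refine add_le_add le_rfl ?_
        have h1 : ∫⁻ z, ENNReal.ofReal ((log R)⁻¹ * (u z * (1 + ‖z.1‖ ^ 2 + ‖z.2‖ ^ 2 + |log (u z)|)))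
            ∂((volume : Measure E).prod volume) =
            ENNReal.ofReal (log R)⁻¹ * ∫⁻ z, ENNReal.ofReal (u z * (1 + ‖z.1‖ ^ 2 + ‖z.2‖ ^ 2 + |log (u z)|))
              ∂((volume : Measure E).prod volume) := by
          rw [← lintegral_const_mul' _ _ ENNReal.ofReal_ne_top]
          exact lintegral_congr fun z => ENNReal.ofReal_mul (inv_nonneg.2 hlogR.le)
        rw [h1, div_eq_inv_mul, ENNReal.ofReal_mul (inv_nonneg.2 hlogR.le)]
        exact mul_le_mul' le_rfl hC

/-- **The entropy tail bound**: if `∫∫ u (1 + |x|² + |v|² + |log u|) ≤ C` then for `R > 1`,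
`∫_{u > R} u ≤ C / log R`. [cite: CIPDiluteGases1994, §5.3 Step 8 (3.25)–(3.26) (p. 147)] -/
theorem lintegral_tail_le_of_massEntropy_le {u : E × E → ℝ} (hum : Measurable u)
    {C : ℝ} (hC : ∫⁻ z, ENNReal.ofReal (u z * (1 + ‖z.1‖ ^ 2 + ‖z.2‖ ^ 2 + |log (u z)|))
      ∂((volume : Measure E).prod volume) ≤ ENNReal.ofReal C)
    {R : ℝ} (hR : 1 < R) :
    ∫⁻ z in {z | R < u z}, ENNReal.ofReal (u z) ∂((volume : Measure E).prod volume) ≤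
      ENNReal.ofReal (C / log R) := by
  have hlogR : 0 < log R := log_pos hR
  have hSm : MeasurableSet {z : E × E | R < u z} := measurableSet_lt measurable_const hum
  calc ∫⁻ z in {z | R < u z}, ENNReal.ofReal (u z) ∂((volume : Measure E).prod volume)
      ≤ ∫⁻ z in {z | R < u z}, ENNReal.ofReal ((log R)⁻¹ * (u z * (1 + ‖z.1‖ ^ 2 + ‖z.2‖ ^ 2 + |log (u z)|)))
          ∂((volume : Measure E).prod volume) := by
        refine setLIntegral_mono' hSm fun z hz => ENNReal.ofReal_le_ofReal ?_
        have huz : R < u z := hz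
        have hupos : 0 < u z := lt_trans (lt_trans zero_lt_one hR) huz
        have hlog : log R ≤ log (u z) := log_le_log (lt_trans zero_lt_one hR) huz.le
        have hlog0 : 0 < log (u z) := hlogR.trans_le hlog
        rw [abs_of_pos hlog0]
        have h1 : u z * log R ≤ u z * (1 + ‖z.1‖ ^ 2 + ‖z.2‖ ^ 2 + log (u z)) := by
          refine mul_le_mul_of_nonneg_left ?_ hupos.le
          nlinarith [sq_nonneg ‖z.1‖, sq_nonneg ‖z.2‖]
        rw [inv_mul_eq_div, le_div_iff₀ hlogR]
        exact h1
    _ ≤ ∫⁻ z, ENNReal.ofReal ((log R)⁻¹ * (u z * (1 + ‖z.1‖ ^ 2 + ‖z.2‖ ^ 2 + |log (u z)|)))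
          ∂((volume : Measure E).prod volume) := lintegral_mono' Measure.restrict_le_self le_rfl
    _ = ENNReal.ofReal (log R)⁻¹ * ∫⁻ z, ENNReal.ofReal (u z * (1 + ‖z.1‖ ^ 2 + ‖z.2‖ ^ 2 + |log (u z)|))
          ∂((volume : Measure E).prod volume) := by
        rw [← lintegral_const_mul' _ _ ENNReal.ofReal_ne_top]
        exact lintegral_congr fun z => ENNReal.ofReal_mul (inv_nonneg.2 hlogR.le)
    _ ≤ ENNReal.ofReal (C / log R) := by
        rw [div_eq_inv_mul, ENNReal.ofReal_mul (inv_nonneg.2 hlogR.le)]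
        exact mul_le_mul' le_rfl hC

end Elementary



section Shear

variable {E : Type*} [NormedAddCommGroup E] [InnerProductSpace ℝ E] [FiniteDimensional ℝ E]
  [MeasurableSpace E] [BorelSpace E]

/-- **Integration along sheared characteristics, one slice**: for measurable `G ≥ 0` on `E × E`
and a measurable set `C` of characteristics,
`∫_C G(x + t v, v) d(x,v) = ∫ 1_C(y - t v, v) G(y, v) d(y, v)` (invariance of Lebesgue measure
under the free-streaming shear, CIP 1994 §5.3 Step 4). [cite: CIPDiluteGases1994, §5.3 Step 4 (p. 143)] -/
theorem setLIntegral_sharp_eq_lintegral_indicator {G : E × E → ℝ≥0∞} (hG : Measurable G)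
    {C : Set (E × E)} (hC : MeasurableSet C) (t : ℝ) :
    ∫⁻ z in C, G (z.1 + t • z.2, z.2) ∂((volume : Measure E).prod volume) =
      ∫⁻ y, C.indicator (fun _ => (1 : ℝ≥0∞)) (y.1 - t • y.2, y.2) * G y
        ∂((volume : Measure E).prod volume) := by
  -- the inverse shear `(y, v) ↦ (y - t v, v)` preserves the measure
  have hmp := measurePreserving_freeShear (E := E) (-t)
  have hH : Measurable fun z : E × E => C.indicator (fun _ => (1 : ℝ≥0∞)) z * G (z.1 + t • z.2, z.2) :=
    (measurable_const.indicator hC).mul (hG.comp ((measurable_fst.add (measurable_snd.const_smul t)).prodMk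
      measurable_snd))
  rw [← lintegral_indicator hC]
  have h1 : ∀ z : E × E, C.indicator (fun z => G (z.1 + t • z.2, z.2)) z =
      C.indicator (fun _ => (1 : ℝ≥0∞)) z * G (z.1 + t • z.2, z.2) := fun z => by
    by_cases hz : z ∈ C <;> simp [hz]
  simp only [h1]
  rw [← hmp.lintegral_comp hH]
  refine lintegral_congr fun y => ?_
  simp only [neg_smul, ← sub_eq_add_neg, sub_add_cancel]

/-- **Integration along sheared characteristics, with the time variable**: for measurable `H ≥ 0`
on `ℝ × E × E` and a measurable set `C` of characteristics,
`∫_C ∫_{(0,t)} H(s, x + s v, v) ds d(x,v) = ∫ 1_{(0,t)}(s) 1_C(y - s v, v) H(s, y, v) d(s,y,v)`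
(Tonelli and the shear slice by slice). [cite: CIPDiluteGases1994, §5.3 Step 4 (p. 143)] -/
theorem setLIntegral_lintegral_Ioo_sharp_eq {H : ℝ × E × E → ℝ≥0∞} (hH : Measurable H)
    {C : Set (E × E)} (hC : MeasurableSet C) (t : ℝ) :
    ∫⁻ z in C, (∫⁻ s in Ioo 0 t, H (s, z.1 + s • z.2, z.2)) ∂((volume : Measure E).prod volume) =
      ∫⁻ q, (Ioo 0 t).indicator (fun _ => (1 : ℝ≥0∞)) q.1 *
        (C.indicator (fun _ => (1 : ℝ≥0∞)) (q.2.1 - q.1 • q.2.2, q.2.2) * H q)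
        ∂(volume : Measure (ℝ × E × E)) := by
  -- measurability of `(s, z) ↦ H(s, x + s v, v)`
  have hsh : Measurable fun p : ℝ × E × E => H (p.1, p.2.1 + p.1 • p.2.2, p.2.2) :=
    hH.comp measurableEmbedding_shearFlow.measurable
  have hsh' : Measurable fun p : (E × E) × ℝ => H (p.2, p.1.1 + p.2 • p.1.2, p.1.2) :=
    hsh.comp (measurable_snd.prodMk measurable_fst)
  -- left side as an integral over `C × (0,t)` then swap
  rw [show (volume : Measure (ℝ × E × E)) = (volume : Measure ℝ).prod ((volume : Measure E).prod volume)
    from rfl]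
  have hK : Measurable fun q : ℝ × E × E => (Ioo 0 t).indicator (fun _ => (1 : ℝ≥0∞)) q.1 *
      (C.indicator (fun _ => (1 : ℝ≥0∞)) (q.2.1 - q.1 • q.2.2, q.2.2) * H q) :=
    ((measurable_const.indicator measurableSet_Ioo).comp measurable_fst).mul
      (((measurable_const.indicator hC).comp ((measurable_snd.fst.sub
        (measurable_fst.smul measurable_snd.snd)).prodMk measurable_snd.snd)).mul hH)
  rw [lintegral_prod _ hK.aemeasurable]
  -- the `s`-integral first: an integral over `(0, t)`
  have h1 : ∀ s : ℝ, ∫⁻ y : E × E, (Ioo 0 t).indicator (fun _ => (1 : ℝ≥0∞)) s *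
      (C.indicator (fun _ => (1 : ℝ≥0∞)) (y.1 - s • y.2, y.2) * H (s, y)) ∂((volume : Measure E).prod volume) =
      (Ioo 0 t).indicator (fun _ => (1 : ℝ≥0∞)) s *
        ∫⁻ z in C, H (s, z.1 + s • z.2, z.2) ∂((volume : Measure E).prod volume) := by
    intro s
    have hm : Measurable fun y : E × E => C.indicator (fun _ => (1 : ℝ≥0∞)) (y.1 - s • y.2, y.2) * H (s, y) :=
      ((measurable_const.indicator hC).comp ((measurable_fst.sub (measurable_snd.const_smul s)).prodMk
        measurable_snd)).mul (hH.comp (measurable_const.prodMk measurable_id))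
    rw [lintegral_const_mul _ hm, setLIntegral_sharp_eq_lintegral_indicator (G := fun y => H (s, y))
      (hH.comp (measurable_const.prodMk measurable_id)) hC s]
  simp only [h1]
  have h2 : ∀ s : ℝ, (Ioo 0 t).indicator (fun s => ∫⁻ z in C, H (s, z.1 + s • z.2, z.2)
      ∂((volume : Measure E).prod volume)) s = (Ioo 0 t).indicator (fun _ => (1 : ℝ≥0∞)) s *
        ∫⁻ z in C, H (s, z.1 + s • z.2, z.2) ∂((volume : Measure E).prod volume) := fun s => by
    by_cases hs : s ∈ Ioo 0 t <;> simp [hs]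
  simp only [← h2]
  rw [lintegral_indicator measurableSet_Ioo]
  -- Tonelli
  exact lintegral_lintegral_swap hsh'.aemeasurable

end Shear


/-! ## Along the approximating sequence: slices along characteristics -/

section Slices

universe u

variable {E : Type u} [NormedAddCommGroup E] [InnerProductSpace ℝ E] [FiniteDimensional ℝ E]
  [MeasurableSpace E] [BorelSpace E]

variable {B : E × E → sphere (0 : E) 1 → ℝ} {f₀ : E → E → ℝ} {δ : ℕ → ℝ}
  {Bseq : ℕ → E × E → sphere (0 : E) 1 → ℝ} {fseq : ℕ → ℝ → E → E → ℝ} {φ : ℕ → ℕ}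
  {f : ℝ → E → E → ℝ}

/-- **The slices along characteristics converge on every measurable set of characteristics**:
`∫_C f^{φ(k)}♯(t) → ∫_C f♯(t)` (weak `L¹` convergence of the slices `f^{φ(k)}(t) ⇀ f(t)` tested
against `1_C(y - t v, v)`, and the shear). [cite: CIPDiluteGases1994, §5.3 Step 10 (p. 151) and Step 4 (p. 143)] -/
theorem IsDiPernaLionsWeakLimit.tendsto_setLIntegral_sharp (hW : IsDiPernaLionsWeakLimit f₀ fseq φ f)
    (hsol : ∀ n, IsDiPernaLionsApproximateSolution (δ n) (Bseq n) (fseq n)) {t : ℝ} (ht : 0 ≤ t)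
    {C : Set (E × E)} (hC : MeasurableSet C) :
    Tendsto (fun k => ∫⁻ z in C, ENNReal.ofReal (fseq (φ k) t (z.1 + t • z.2) z.2)
      ∂((volume : Measure E).prod volume)) atTop
      (𝓝 (∫⁻ z in C, ENNReal.ofReal (f t (z.1 + t • z.2) z.2) ∂((volume : Measure E).prod volume))) := by
  set θ : E × E → ℝ := fun y => C.indicator (fun _ => (1 : ℝ)) (y.1 - t • y.2, y.2) with hθ
  have hθm : Measurable θ :=
    (measurable_const.indicator hC).comp ((measurable_fst.sub (measurable_snd.const_smul t)).prodMk measurable_snd)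
  have hθ01 : ∀ y, 0 ≤ θ y ∧ θ y ≤ 1 := fun y => by
    by_cases hy : (y.1 - t • y.2, y.2) ∈ C <;> simp [hθ, hy]
  -- the set integrals as pairings with `θ`
  have key : ∀ {u : E × E → ℝ}, Measurable u → (∀ z, 0 ≤ u z) → Integrable u ((volume : Measure E).prod volume) →
      ∫⁻ z in C, ENNReal.ofReal (u (z.1 + t • z.2, z.2)) ∂((volume : Measure E).prod volume) =
        ENNReal.ofReal (∫ y, u y * θ y ∂((volume : Measure E).prod volume)) := by
    intro u hum hu0 hui
    rw [setLIntegral_sharp_eq_lintegral_indicator (G := fun y => ENNReal.ofReal (u y)) hum.ennreal_ofReal hC t]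
    have h1 : ∀ y : E × E, C.indicator (fun _ => (1 : ℝ≥0∞)) (y.1 - t • y.2, y.2) * ENNReal.ofReal (u y) =
        ENNReal.ofReal (u y * θ y) := fun y => by
      by_cases hy : (y.1 - t • y.2, y.2) ∈ C <;> simp [hθ, hy]
    simp only [h1]
    have hbd : ∀ᵐ y ∂((volume : Measure E).prod volume), ‖θ y‖ ≤ 1 := ae_of_all _ fun y => by
      rw [Real.norm_eq_abs, abs_of_nonneg (hθ01 y).1]; exact (hθ01 y).2
    exact (ofReal_integral_eq_lintegral_ofReal (hui.mul_bdd hθm.aestronglyMeasurable hbd)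
      (ae_of_all _ fun y => mul_nonneg (hu0 y) (hθ01 y).1)).symm
  have hk : ∀ k, ∫⁻ z in C, ENNReal.ofReal (fseq (φ k) t (z.1 + t • z.2) z.2) ∂((volume : Measure E).prod volume) =
      ENNReal.ofReal (∫ y, fseq (φ k) t y.1 y.2 * θ y ∂((volume : Measure E).prod volume)) := fun k =>
    key ((hsol (φ k)).contDiff_slice t ht).continuous.measurable (fun z => (hsol (φ k)).nonneg t ht _ _)
      ((hsol (φ k)).integrable_slice t ht)
  have hl : ∫⁻ z in C, ENNReal.ofReal (f t (z.1 + t • z.2) z.2) ∂((volume : Measure E).prod volume) =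
      ENNReal.ofReal (∫ y, f t y.1 y.2 * θ y ∂((volume : Measure E).prod volume)) :=
    key (hW.measurable_slice t) (fun z => hW.nonneg t ht _ _) (hW.integrable_slice ht)
  simp only [hk, hl]
  exact ENNReal.tendsto_ofReal (hW.tendstoWeaklyL1_slice t ht θ 1 hθm.aestronglyMeasurable
    (ae_of_all _ fun y => by rw [abs_of_nonneg (hθ01 y).1]; exact (hθ01 y).2))

/-- **Uniform smallness of the slices along characteristics on small sets of characteristics**
(equi-integrability from the entropy bound (3.21), and the shear): for `t ≥ 0` and `ε > 0` there is
`m > 0` with `∫_S fⁿ♯(t) ≤ ε` for all `n` and all measurable `S` with `|S| ≤ m`. [cite: CIPDiluteGases1994, §5.3 (3.21), (3.25)–(3.26) (p. 147)] -/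
theorem exists_setLIntegral_sharp_le_of_measure_le
    (hsol : ∀ n, IsDiPernaLionsApproximateSolution (δ n) (Bseq n) (fseq n))
    (hbd : UniformDiPernaLionsBounds δ Bseq fseq) {t : ℝ} (ht : 0 ≤ t) {ε : ℝ} (hε : 0 < ε) :
    ∃ m : ℝ, 0 < m ∧ ∀ (n : ℕ) (S : Set (E × E)), MeasurableSet S →
      ((volume : Measure E).prod volume) S ≤ ENNReal.ofReal m →
      ∫⁻ z in S, ENNReal.ofReal (fseq n t (z.1 + t • z.2) z.2) ∂((volume : Measure E).prod volume) ≤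
        ENNReal.ofReal ε := by
  obtain ⟨Cm₀, hCm₀⟩ := hbd.massEntropy_le t ht
  set Cm : ℝ := max Cm₀ 0 with hCm
  have hCm0 : 0 ≤ Cm := le_max_right _ _
  -- `R` with `Cm / log R ≤ ε / 2`, then `m = ε / (2 R)`
  set LR : ℝ := 2 * (Cm + 1) / ε with hLR
  have hLRpos : 0 < LR := by positivity
  set R : ℝ := exp LR with hR
  have hR1 : 1 < R := by rw [hR]; exact Real.one_lt_exp_iff.2 hLRpos
  have hRpos : 0 < R := exp_pos _
  have htail : Cm / log R ≤ ε / 2 := by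
    rw [hR, log_exp, div_le_iff₀ hLRpos, hLR]
    have : ε / 2 * (2 * (Cm + 1) / ε) = Cm + 1 := by field_simp
    rw [this]; linarith
  refine ⟨ε / (2 * R), by positivity, fun n S hS hμS => ?_⟩
  have hsoln := hsol n
  have hum : Measurable fun z : E × E => fseq n t z.1 z.2 := (hsoln.contDiff_slice t ht).continuous.measurable
  -- shear: `∫_S fⁿ♯(t) = ∫_{S'} fⁿ(t)` with `|S'| = |S|`
  set S' : Set (E × E) := (fun y : E × E => (y.1 - t • y.2, y.2)) ⁻¹' S with hS'
  have hg : Measurable fun y : E × E => (y.1 - t • y.2, y.2) :=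
    (measurable_fst.sub (measurable_snd.const_smul t)).prodMk measurable_snd
  have hS'm : MeasurableSet S' := hg hS
  have hvol : ((volume : Measure E).prod volume) S' = ((volume : Measure E).prod volume) S := by
    have hmp := measurePreserving_freeShear (E := E) (-t)
    have : (fun y : E × E => (y.1 - t • y.2, y.2)) = fun z : E × E => (z.1 + (-t) • z.2, z.2) := by
      funext y; simp [sub_eq_add_neg]
    rw [hS', this]
    exact hmp.measure_preimage hS.nullMeasurableSet
  have hshear : ∫⁻ z in S, ENNReal.ofReal (fseq n t (z.1 + t • z.2) z.2) ∂((volume : Measure E).prod volume) =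
      ∫⁻ y in S', ENNReal.ofReal (fseq n t y.1 y.2) ∂((volume : Measure E).prod volume) := by
    rw [setLIntegral_sharp_eq_lintegral_indicator (G := fun y => ENNReal.ofReal (fseq n t y.1 y.2))
      hum.ennreal_ofReal hS t, ← lintegral_indicator hS'm]
    refine lintegral_congr fun y => ?_
    by_cases hy : y ∈ S'
    · rw [indicator_of_mem hy, indicator_of_mem (show (y.1 - t • y.2, y.2) ∈ S from hy), one_mul]
    · rw [indicator_of_notMem hy, indicator_of_notMem (show (y.1 - t • y.2, y.2) ∉ S from hy), zero_mul]
  rw [hshear]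
  have hC : ∫⁻ z, ENNReal.ofReal (fseq n t z.1 z.2 * (1 + ‖z.1‖ ^ 2 + ‖z.2‖ ^ 2 + |log (fseq n t z.1 z.2)|))
      ∂((volume : Measure E).prod volume) ≤ ENNReal.ofReal Cm :=
    (hCm₀ n t ⟨ht, le_rfl⟩).trans (ENNReal.ofReal_le_ofReal (le_max_left _ _))
  calc ∫⁻ y in S', ENNReal.ofReal (fseq n t y.1 y.2) ∂((volume : Measure E).prod volume)
      ≤ ENNReal.ofReal R * ((volume : Measure E).prod volume) S' + ENNReal.ofReal (Cm / log R) :=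
        setLIntegral_le_of_massEntropy_le (u := fun z : E × E => fseq n t z.1 z.2) hum hC hR1 S'
    _ ≤ ENNReal.ofReal R * ENNReal.ofReal (ε / (2 * R)) + ENNReal.ofReal (ε / 2) := by
        rw [hvol]
        exact add_le_add (mul_le_mul' le_rfl hμS) (ENNReal.ofReal_le_ofReal htail)
    _ = ENNReal.ofReal ε := by
        rw [← ENNReal.ofReal_mul hRpos.le, ← ENNReal.ofReal_add (by positivity) (by positivity)]
        congr 1
        field_simp
        ring

end Slices


/-! ## The exceptional set of the level truncation and the data term -/

section Exceptional

universe u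

variable {E : Type u} [NormedAddCommGroup E] [InnerProductSpace ℝ E] [FiniteDimensional ℝ E]
  [MeasurableSpace E] [BorelSpace E]

variable {B : E × E → sphere (0 : E) 1 → ℝ} {f₀ : E → E → ℝ} {δ : ℕ → ℝ}
  {Bseq : ℕ → E × E → sphere (0 : E) 1 → ℝ} {fseq : ℕ → ℝ → E → E → ℝ} {φ : ℕ → ℕ}
  {f : ℝ → E → E → ℝ}

/-- The total mass of a slice along characteristics is the total mass of the slice. [folklore] -/
theorem lintegral_ofReal_sharp_eq {u : E × E → ℝ} (hum : Measurable u) (t : ℝ) :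
    ∫⁻ z, ENNReal.ofReal (u (z.1 + t • z.2, z.2)) ∂((volume : Measure E).prod volume) =
      ∫⁻ y, ENNReal.ofReal (u y) ∂((volume : Measure E).prod volume) := by
  have h := setLIntegral_sharp_eq_lintegral_indicator (G := fun y => ENNReal.ofReal (u y)) hum.ennreal_ofReal
    MeasurableSet.univ t
  rw [Measure.restrict_univ] at h
  rw [h]
  exact lintegral_congr fun y => by simp

/-- **The exceptional set of the level truncation carries little mass, uniformly along the
sequence** (for the tree's level truncation `DiPernaLionsGainLevelTruncation` of the subsolution
half of CIP 1994 Lemma 5.3.12): for `t ≥ 0`, a measurable set `C ⊆ E × B̄_{R_v}` of finite measure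
and `ε > 0` there is a level `M > 0` such that, eventually in `k`,
`∫_{C ∩ {e^{Λₖ♯(t)} f^{φ(k)}♯(t) > M}} f^{φ(k)}♯(t) ≤ ε`: the exceptional set lies in
`{F♯(t) > L₀} ∪ {|Λₖ♯(t) - F♯(t)| ≥ 1} ∪ {f^{φ(k)}♯(t) > M e^{-L₀-1}}`, of small measure for `L₀`,
then `M`, then `k` large (`Λₖ♯(t) → F♯(t)` in `L¹(E × B̄_{R_v})`, `DiPernaLionsDampingLimit`), and the
slices are equi-integrable (`exists_setLIntegral_sharp_le_of_measure_le`). [cite: CIPDiluteGases1994, §5.3 Lemma 5.3.12, proof (pp. 158–159)] -/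
theorem exists_level_eventually_setLIntegral_exceptional_le (hB : IsDiPernaLionsKernel B)
    (hf₀ : HasDiPernaLionsData f₀) (hδ : ∀ n, 0 < δ n) (hanti : Antitone δ)
    (hlim : Tendsto δ atTop (𝓝 0)) (hker : IsDiPernaLionsKernelApproximation B Bseq)
    (hdata : IsDiPernaLionsDataApproximation f₀ (fun n => fseq n 0))
    (hsol : ∀ n, IsDiPernaLionsApproximateSolution (δ n) (Bseq n) (fseq n))
    (hbd : UniformDiPernaLionsBounds δ Bseq fseq) (hW : IsDiPernaLionsWeakLimit f₀ fseq φ f) {t : ℝ}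
    (ht : 0 ≤ t) {C : Set (E × E)} (hC : MeasurableSet C) {Rv : ℝ}
    (hCsub : C ⊆ univ ×ˢ closedBall (0 : E) Rv) (hCfin : ((volume : Measure E).prod volume) C ≠ ∞)
    {ε : ℝ} (hε : 0 < ε) :
    ∃ M : ℝ, 0 < M ∧ ∀ᶠ k in atTop,
      ∫⁻ z in C ∩ {z | M < exp (truncatedDampingExponent (δ (φ k)) (Bseq (φ k)) (fseq (φ k)) t z.1 z.2) *
          fseq (φ k) t (z.1 + t • z.2) z.2}, ENNReal.ofReal (fseq (φ k) t (z.1 + t • z.2) z.2)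
        ∂((volume : Measure E).prod volume) ≤ ENNReal.ofReal ε := by
  set μ : Measure (E × E) := (volume : Measure E).prod volume with hμ
  obtain ⟨m, hm, hsmall⟩ := exists_setLIntegral_sharp_le_of_measure_le hsol hbd ht hε
  -- the limit damping exponent is finite everywhere: `|C ∩ {F > L}| → 0`
  set F : E × E → ℝ := fun z => dampingExponent B f t z.1 z.2 with hF
  have hFm : Measurable F :=
    (measurable_dampingExponent hB.measurable hW.measurable).comp (measurable_const.prodMk measurable_id)
  set A : ℕ → Set (E × E) := fun L => C ∩ {z | (L : ℝ) < F z} with hA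
  have hAm : ∀ L, MeasurableSet (A L) := fun L => hC.inter (measurableSet_lt measurable_const hFm)
  have hAanti : Antitone A := by
    intro L L' hLL' z hz
    refine ⟨hz.1, ?_⟩
    have h2 : (L' : ℝ) < F z := hz.2
    have h3 : (L : ℝ) ≤ L' := by exact_mod_cast hLL'
    exact lt_of_le_of_lt h3 h2
  have hAinter : ⋂ L, A L = ∅ := by
    ext z
    simp only [mem_iInter, mem_empty_iff_false, iff_false, not_forall]
    obtain ⟨L, hL⟩ := exists_nat_gt (F z)
    exact ⟨L, fun h => (lt_irrefl _ (h.2.trans hL))⟩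
  have hAlim : Tendsto (fun L => μ (A L)) atTop (𝓝 0) := by
    have h := tendsto_measure_iInter_atTop (μ := μ) (fun L => (hAm L).nullMeasurableSet) hAanti
      ⟨0, ne_top_of_le_ne_top hCfin (measure_mono inter_subset_left)⟩
    rwa [hAinter, measure_empty] at h
  have hm3 : (0 : ℝ≥0∞) < ENNReal.ofReal (m / 3) := ENNReal.ofReal_pos.2 (by positivity)
  obtain ⟨L₀, hL₀⟩ := (hAlim.eventually (gt_mem_nhds hm3)).exists
  -- the mass bound at time `t`
  obtain ⟨Cm₀, hCm₀⟩ := hbd.massEntropy_le t ht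
  set Cm : ℝ := max Cm₀ 0 with hCm
  have hCm0 : 0 ≤ Cm := le_max_right _ _
  have hmass : ∀ n, ∫⁻ z, ENNReal.ofReal (fseq n t (z.1 + t • z.2) z.2) ∂μ ≤ ENNReal.ofReal Cm := by
    intro n
    rw [hμ, lintegral_ofReal_sharp_eq ((hsol n).contDiff_slice t ht).continuous.measurable t]
    refine le_trans (lintegral_mono fun z => ENNReal.ofReal_le_ofReal ?_)
      ((hCm₀ n t ⟨ht, le_rfl⟩).trans (ENNReal.ofReal_le_ofReal (le_max_left _ _)))
    refine le_mul_of_one_le_right ((hsol n).nonneg t ht _ _) ?_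
    nlinarith [sq_nonneg ‖z.1‖, sq_nonneg ‖z.2‖, abs_nonneg (log (fseq n t z.1 z.2))]
  -- the level
  set L₁ : ℝ := (L₀ : ℝ) + 1 with hL₁
  set M : ℝ := 3 * (Cm + 1) * exp L₁ / m with hM
  have hMpos : 0 < M := by positivity
  have hMe : ENNReal.ofReal Cm / ENNReal.ofReal (M * exp (-L₁)) ≤ ENNReal.ofReal (m / 3) := by
    have hpos : 0 < M * exp (-L₁) := by positivity
    rw [ENNReal.div_le_iff (ENNReal.ofReal_pos.2 hpos).ne' ENNReal.ofReal_ne_top, ← ENNReal.ofReal_mul (by positivity)]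
    refine ENNReal.ofReal_le_ofReal ?_
    have hexp : exp L₁ * exp (-L₁) = 1 := by rw [← Real.exp_add, add_neg_cancel, Real.exp_zero]
    have : m / 3 * (M * exp (-L₁)) = Cm + 1 := by
      rw [hM]
      field_simp
      linear_combination hexp
    linarith
  refine ⟨M, hMpos, ?_⟩
  -- `Λₖ♯(t) → F♯(t)` in `L¹(E × B̄_{R_v})`
  have hΛlim := tendsto_lintegral_enorm_truncatedDampingExponent_sub velocityAverage_relativelyCompact_L1_holds
    hB hf₀ hδ hanti hlim hker hdata hsol hbd hW (T := t) (t := t) ⟨ht, le_rfl⟩ Rv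
  have hev := hΛlim.eventually (gt_mem_nhds hm3)
  filter_upwards [hev] with k hk
  set Λk : E × E → ℝ := fun z => truncatedDampingExponent (δ (φ k)) (Bseq (φ k)) (fseq (φ k)) t z.1 z.2 with hΛk
  have hsolk := hsol (φ k)
  have hBk := hker.isDiPernaLionsKernel (φ k)
  have hΛkm : Measurable Λk :=
    (hsolk.measurable_truncatedDampingExponent hBk.measurable).comp (measurable_const.prodMk measurable_id)
  have hfkm : Measurable fun z : E × E => fseq (φ k) t (z.1 + t • z.2) z.2 :=
    ((hsolk.contDiff_slice t ht).continuous.measurable).comp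
      ((measurable_fst.add (measurable_snd.const_smul t)).prodMk measurable_snd)
  set S : Set (E × E) := {z | M < exp (Λk z) * fseq (φ k) t (z.1 + t • z.2) z.2} with hS
  have hSm : MeasurableSet S := measurableSet_lt measurable_const (hΛkm.exp.mul hfkm)
  -- the exceptional set is small
  have hsub : C ∩ S ⊆ A L₀ ∪ (C ∩ {z | (1 : ℝ≥0∞) ≤ ‖Λk z - F z‖ₑ}) ∪
      {z | ENNReal.ofReal (M * exp (-L₁)) ≤ ENNReal.ofReal (fseq (φ k) t (z.1 + t • z.2) z.2)} := by
    rintro z ⟨hzC, hzS⟩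
    by_contra h
    simp only [mem_union, not_or, hA, mem_inter_iff, mem_setOf_eq, not_and, not_lt, not_le] at h
    obtain ⟨⟨h1, h2⟩, h3⟩ := h
    have hF : F z ≤ L₀ := h1 hzC
    have hd : ‖Λk z - F z‖ₑ < 1 := h2 hzC
    have hd' : |Λk z - F z| < 1 := by
      rw [Real.enorm_eq_ofReal_abs, ← ENNReal.ofReal_one, ENNReal.ofReal_lt_ofReal_iff one_pos] at hd
      exact hd
    have hΛ : Λk z < L₁ := by rw [hL₁]; linarith [(abs_lt.1 hd').2]
    have hfz : fseq (φ k) t (z.1 + t • z.2) z.2 < M * exp (-L₁) :=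
      (ENNReal.ofReal_lt_ofReal_iff (by positivity)).1 h3
    have hft : 0 ≤ fseq (φ k) t (z.1 + t • z.2) z.2 := hsolk.nonneg t ht _ _
    have : exp (Λk z) * fseq (φ k) t (z.1 + t • z.2) z.2 < exp L₁ * (M * exp (-L₁)) :=
      mul_lt_mul'' (exp_lt_exp.2 hΛ) hfz (exp_pos _).le hft
    rw [mul_left_comm, ← Real.exp_add, add_neg_cancel, Real.exp_zero, mul_one] at this
    exact lt_irrefl _ (this.trans hzS)
  have hμCS : μ (C ∩ S) ≤ ENNReal.ofReal m := by
    have h1 : μ (A L₀) ≤ ENNReal.ofReal (m / 3) := hL₀.le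
    have h2 : μ (C ∩ {z | (1 : ℝ≥0∞) ≤ ‖Λk z - F z‖ₑ}) ≤ ENNReal.ofReal (m / 3) := by
      have hdm : Measurable fun z => ‖Λk z - F z‖ₑ := (hΛkm.sub hFm).enorm
      have hMarkov := meas_ge_le_lintegral_div (μ := μ.restrict C) hdm.aemeasurable one_ne_zero ENNReal.one_ne_top
      rw [Measure.restrict_apply (measurableSet_le measurable_const hdm), inter_comm, div_one] at hMarkov
      refine hMarkov.trans (le_trans ?_ hk.le)
      calc ∫⁻ z in C, ‖Λk z - F z‖ₑ ∂μ ≤ ∫⁻ z in univ ×ˢ closedBall (0 : E) Rv, ‖Λk z - F z‖ₑ ∂μ :=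
            lintegral_mono_set hCsub
        _ = _ := rfl
    have h3 : μ {z | ENNReal.ofReal (M * exp (-L₁)) ≤ ENNReal.ofReal (fseq (φ k) t (z.1 + t • z.2) z.2)} ≤
        ENNReal.ofReal (m / 3) := by
      refine (meas_ge_le_lintegral_div hfkm.ennreal_ofReal.aemeasurable
        (ENNReal.ofReal_pos.2 (by positivity)).ne' ENNReal.ofReal_ne_top).trans ?_
      exact (ENNReal.div_le_div_right (hmass (φ k)) _).trans hMe
    calc μ (C ∩ S) ≤ μ (A L₀ ∪ (C ∩ {z | (1 : ℝ≥0∞) ≤ ‖Λk z - F z‖ₑ}) ∪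
          {z | ENNReal.ofReal (M * exp (-L₁)) ≤ ENNReal.ofReal (fseq (φ k) t (z.1 + t • z.2) z.2)}) :=
          measure_mono hsub
      _ ≤ μ (A L₀) + μ (C ∩ {z | (1 : ℝ≥0∞) ≤ ‖Λk z - F z‖ₑ}) +
          μ {z | ENNReal.ofReal (M * exp (-L₁)) ≤ ENNReal.ofReal (fseq (φ k) t (z.1 + t • z.2) z.2)} :=
          (measure_union_le _ _).trans (add_le_add (measure_union_le _ _) le_rfl)
      _ ≤ ENNReal.ofReal (m / 3) + ENNReal.ofReal (m / 3) + ENNReal.ofReal (m / 3) :=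
          add_le_add (add_le_add h1 h2) h3
      _ = ENNReal.ofReal m := by
          rw [← ENNReal.ofReal_add (by positivity) (by positivity), ← ENNReal.ofReal_add (by positivity) (by positivity)]
          congr 1; ring
  exact hsmall (φ k) (C ∩ S) (hC.inter hSm) hμCS

end Exceptional


/-! ## The data term -/

section Data

universe u

variable {E : Type u} [NormedAddCommGroup E] [InnerProductSpace ℝ E] [FiniteDimensional ℝ E]
  [MeasurableSpace E] [BorelSpace E]

variable {B : E × E → sphere (0 : E) 1 → ℝ} {f₀ : E → E → ℝ} {δ : ℕ → ℝ}
  {Bseq : ℕ → E × E → sphere (0 : E) 1 → ℝ} {fseq : ℕ → ℝ → E → E → ℝ} {φ : ℕ → ℕ}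
  {f : ℝ → E → E → ℝ}

omit [NormedAddCommGroup E] [InnerProductSpace ℝ E] [FiniteDimensional ℝ E] [MeasurableSpace E]
  [BorelSpace E] in
/-- `e^{-a} ≤ min(1, e^{-b}) + min(1, |a - b|)` for `a ≥ 0` (the exponential is `1`-Lipschitz and
bounded by `1` on `[0, ∞)`). [folklore] -/
theorem exp_neg_le_min_add_min {a b : ℝ} (ha : 0 ≤ a) :
    exp (-a) ≤ min 1 (exp (-b)) + min 1 |a - b| := by
  have hea : exp (-a) ≤ 1 := by rw [exp_le_one_iff]; linarith
  have hm0 : 0 ≤ min 1 |a - b| := le_min zero_le_one (abs_nonneg _)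
  rcases le_or_gt b a with hba | hab
  · have h1 : exp (-a) ≤ exp (-b) := exp_le_exp.2 (by linarith)
    exact (le_min hea h1).trans (le_add_of_nonneg_right hm0)
  · -- `a < b`: `e^{-a} - e^{-b} ≤ b - a`
    have hb : 0 < b := ha.trans_lt hab
    have heb : exp (-b) ≤ 1 := by rw [exp_le_one_iff]; linarith
    rw [min_eq_right heb]
    have hkey : exp (-a) - exp (-b) ≤ b - a := by
      have h1 : 1 - (b - a) ≤ exp (-(b - a)) := by linarith [add_one_le_exp (-(b - a))]
      have h2 : exp (-b) = exp (-a) * exp (-(b - a)) := by rw [← Real.exp_add]; congr 1; ring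
      have h3 : exp (-a) * (1 - (b - a)) ≤ exp (-a) * exp (-(b - a)) :=
        mul_le_mul_of_nonneg_left h1 (exp_pos _).le
      nlinarith [exp_pos (-a), h3, h2]
    have hkey' : exp (-a) - exp (-b) ≤ 1 := by linarith [exp_pos (-b)]
    have : exp (-a) - exp (-b) ≤ min 1 |a - b| := by
      refine le_min hkey' ?_
      rw [abs_sub_comm, abs_of_pos (by linarith)]
      exact hkey
    linarith

/-- **The data term passes to the limit** (CIP 1994 §5.3 Lemma 5.3.12, the term
`f₀ⁿ e^{-Fₙ} → f₀ e^{-F}` of (3.36)/(3.41) as `n → ∞`, p. 159): for `t ≥ 0`, a measurable set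
`C ⊆ E × B̄_{R_v}` of characteristics and `ε > 0`, eventually
`∫_C f^{φ(k)}(0) e^{-Λₖ♯(t)} ≤ ∫_C f(0) e^{-F♯(t)} + ε` (`f^{φ(k)}(0) → f₀ = f(0)` in `L¹`,
`Λₖ♯(t) → F♯(t)` in `L¹(E × B̄_{R_v})`, and the equi-integrability of `f(0)`). [cite: CIPDiluteGases1994, §5.3 Lemma 5.3.12, proof (p. 159)] -/
theorem eventually_setLIntegral_data_le (hB : IsDiPernaLionsKernel B)
    (hf₀ : HasDiPernaLionsData f₀) (hδ : ∀ n, 0 < δ n) (hanti : Antitone δ)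
    (hlim : Tendsto δ atTop (𝓝 0)) (hker : IsDiPernaLionsKernelApproximation B Bseq)
    (hdata : IsDiPernaLionsDataApproximation f₀ (fun n => fseq n 0))
    (hsol : ∀ n, IsDiPernaLionsApproximateSolution (δ n) (Bseq n) (fseq n))
    (hbd : UniformDiPernaLionsBounds δ Bseq fseq) (hW : IsDiPernaLionsWeakLimit f₀ fseq φ f) {t : ℝ}
    (ht : 0 ≤ t) {C : Set (E × E)} {Rv : ℝ}
    (hCsub : C ⊆ univ ×ˢ closedBall (0 : E) Rv) {ε : ℝ} (hε : 0 < ε) :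
    ∀ᶠ k in atTop, ∫⁻ z in C, ENNReal.ofReal (fseq (φ k) 0 z.1 z.2 *
        exp (-(truncatedDampingExponent (δ (φ k)) (Bseq (φ k)) (fseq (φ k)) t z.1 z.2)))
        ∂((volume : Measure E).prod volume) ≤
      (∫⁻ z in C, ENNReal.ofReal (f 0 z.1 z.2 * exp (-(dampingExponent B f t z.1 z.2)))
        ∂((volume : Measure E).prod volume)) + ENNReal.ofReal ε := by
  set μ : Measure (E × E) := (volume : Measure E).prod volume with hμ
  set F : E × E → ℝ := fun z => dampingExponent B f t z.1 z.2 with hF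
  have hFm : Measurable F :=
    (measurable_dampingExponent hB.measurable hW.measurable).comp (measurable_const.prodMk measurable_id)
  -- the time-zero slice of the limit and its equi-integrability
  have hf0m : Measurable fun z : E × E => f 0 z.1 z.2 := hW.measurable_slice 0
  have hf00 : ∀ z : E × E, 0 ≤ f 0 z.1 z.2 := fun z => hW.nonneg 0 le_rfl _ _
  obtain ⟨C₀, hC₀⟩ := hW.massEntropy_le 0 le_rfl
  have hC₀' := hC₀ 0 ⟨le_rfl, le_rfl⟩
  set C₁ : ℝ := max C₀ 0 with hC₁
  have hC₁0 : 0 ≤ C₁ := le_max_right _ _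
  have hC₁b : ∫⁻ z, ENNReal.ofReal (f 0 z.1 z.2 * (1 + ‖z.1‖ ^ 2 + ‖z.2‖ ^ 2 + |log (f 0 z.1 z.2)|)) ∂μ ≤
      ENNReal.ofReal C₁ := hC₀'.trans (ENNReal.ofReal_le_ofReal (le_max_left _ _))
  -- the truncation level `R'`
  set LR : ℝ := 3 * (C₁ + 1) / ε with hLR
  have hLRpos : 0 < LR := by positivity
  set R' : ℝ := exp LR with hR'
  have hR'1 : 1 < R' := by rw [hR']; exact Real.one_lt_exp_iff.2 hLRpos
  have hR'pos : 0 < R' := exp_pos _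
  have htail : ∫⁻ z in {z | R' < f 0 z.1 z.2}, ENNReal.ofReal (f 0 z.1 z.2) ∂μ ≤ ENNReal.ofReal (ε / 3) := by
    refine (lintegral_tail_le_of_massEntropy_le hf0m hC₁b hR'1).trans (ENNReal.ofReal_le_ofReal ?_)
    rw [hR', log_exp, div_le_iff₀ hLRpos, hLR]
    have : ε / 3 * (3 * (C₁ + 1) / ε) = C₁ + 1 := by field_simp
    rw [this]; linarith
  -- the two convergences
  have hε3 : (0 : ℝ≥0∞) < ENNReal.ofReal (ε / 3) := ENNReal.ofReal_pos.2 (by positivity)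
  have hdat : Tendsto (fun k => ∫⁻ z, ‖fseq (φ k) 0 z.1 z.2 - f 0 z.1 z.2‖ₑ ∂μ) atTop (𝓝 0) := by
    have h := hdata.tendsto_lintegral_sub.comp hW.strictMono.tendsto_atTop
    refine h.congr fun k => lintegral_congr_ae ?_
    filter_upwards [hW.initial_ae] with z hz
    simp only [hz]
  have hΛlim := tendsto_lintegral_enorm_truncatedDampingExponent_sub velocityAverage_relativelyCompact_L1_holds
    hB hf₀ hδ hanti hlim hker hdata hsol hbd hW (T := t) (t := t) ⟨ht, le_rfl⟩ Rv
  have hev1 : ∀ᶠ k in atTop, 2 * ∫⁻ z, ‖fseq (φ k) 0 z.1 z.2 - f 0 z.1 z.2‖ₑ ∂μ < ENNReal.ofReal (ε / 3) := by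
    have h2 : Tendsto (fun k => 2 * ∫⁻ z, ‖fseq (φ k) 0 z.1 z.2 - f 0 z.1 z.2‖ₑ ∂μ) atTop (𝓝 0) := by
      have h := ENNReal.Tendsto.const_mul hdat (Or.inr ENNReal.ofNat_ne_top) (a := 2)
      rwa [mul_zero] at h
    exact h2.eventually (gt_mem_nhds hε3)
  have hev2 : ∀ᶠ k in atTop, ENNReal.ofReal R' * ∫⁻ z in univ ×ˢ closedBall (0 : E) Rv,
      ‖truncatedDampingExponent (δ (φ k)) (Bseq (φ k)) (fseq (φ k)) t z.1 z.2 - dampingExponent B f t z.1 z.2‖ₑ ∂μ <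
      ENNReal.ofReal (ε / 3) := by
    have h2 := ENNReal.Tendsto.const_mul hΛlim (Or.inr ENNReal.ofReal_ne_top) (a := ENNReal.ofReal R')
    rw [mul_zero] at h2
    exact h2.eventually (gt_mem_nhds hε3)
  filter_upwards [hev1, hev2] with k hk1 hk2
  have hsolk := hsol (φ k)
  have hBk := hker.isDiPernaLionsKernel (φ k)
  set Λk : E × E → ℝ := fun z => truncatedDampingExponent (δ (φ k)) (Bseq (φ k)) (fseq (φ k)) t z.1 z.2 with hΛk
  have hΛk0 : ∀ z, 0 ≤ Λk z := fun z => truncatedDampingExponent_nonneg hBk.nonneg (hδ _).le hsolk.nonneg t z.1 z.2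
  have hΛkm : Measurable Λk :=
    (hsolk.measurable_truncatedDampingExponent hBk.measurable).comp (measurable_const.prodMk measurable_id)
  have hfk0 : ∀ z : E × E, 0 ≤ fseq (φ k) 0 z.1 z.2 := fun z => hsolk.nonneg 0 le_rfl _ _
  -- the pointwise bound
  have hpt : ∀ z : E × E, ENNReal.ofReal (fseq (φ k) 0 z.1 z.2 * exp (-(Λk z))) ≤
      ENNReal.ofReal (f 0 z.1 z.2 * exp (-(F z))) + 2 * ‖fseq (φ k) 0 z.1 z.2 - f 0 z.1 z.2‖ₑ +
        ENNReal.ofReal R' * ‖Λk z - F z‖ₑ +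
        {z : E × E | R' < f 0 z.1 z.2}.indicator (fun z => ENNReal.ofReal (f 0 z.1 z.2)) z := by
    intro z
    set a := fseq (φ k) 0 z.1 z.2 with ha
    set b := f 0 z.1 z.2 with hb
    have ha0 : 0 ≤ a := hfk0 z
    have hb0 : 0 ≤ b := hf00 z
    have hexp := exp_neg_le_min_add_min (b := F z) (hΛk0 z)
    set Ψ := min 1 (exp (-(F z))) with hΨ
    set d := min 1 |Λk z - F z| with hd
    have hΨ01 : 0 ≤ Ψ ∧ Ψ ≤ 1 := ⟨le_min zero_le_one (exp_pos _).le, min_le_left _ _⟩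
    have hd01 : 0 ≤ d ∧ d ≤ 1 := ⟨le_min zero_le_one (abs_nonneg _), min_le_left _ _⟩
    -- real inequality: `a e^{-Λ} ≤ b Ψ + 2|a - b| + R' |Λ - F| + b 1_{b > R'}`
    have hI : {z : E × E | R' < f 0 z.1 z.2}.indicator (fun z => ENNReal.ofReal (f 0 z.1 z.2)) z =
        ENNReal.ofReal (if R' < b then b else 0) := by
      by_cases hzb : R' < b
      · rw [indicator_of_mem (show z ∈ {z : E × E | R' < f 0 z.1 z.2} from hzb), if_pos hzb]
      · rw [indicator_of_notMem (show z ∉ {z : E × E | R' < f 0 z.1 z.2} from hzb), if_neg hzb, ENNReal.ofReal_zero]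
    have hreal : a * exp (-(Λk z)) ≤ b * Ψ + 2 * |a - b| + R' * |Λk z - F z| + (if R' < b then b else 0) := by
      have h1 : a * exp (-(Λk z)) ≤ a * Ψ + a * d := by nlinarith [hexp, ha0]
      have h2 : a * Ψ ≤ b * Ψ + |a - b| := by
        have : a * Ψ - b * Ψ = (a - b) * Ψ := by ring
        nlinarith [abs_mul_self (a - b), le_abs_self (a - b), hΨ01.1, hΨ01.2, abs_nonneg (a - b)]
      have h3 : a * d ≤ b * d + |a - b| := by
        nlinarith [le_abs_self (a - b), hd01.1, hd01.2, abs_nonneg (a - b)]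
      have h4 : b * d ≤ R' * |Λk z - F z| + (if R' < b then b else 0) := by
        by_cases hzb : R' < b
        · rw [if_pos hzb]
          have : b * d ≤ b := by nlinarith [hd01.2, hb0]
          nlinarith [abs_nonneg (Λk z - F z), hR'pos.le]
        · rw [if_neg hzb, add_zero]
          rw [not_lt] at hzb
          calc b * d ≤ R' * d := mul_le_mul_of_nonneg_right hzb hd01.1
            _ ≤ R' * |Λk z - F z| := mul_le_mul_of_nonneg_left (min_le_right _ _) hR'pos.le
      linarith
    have hi0 : 0 ≤ (if R' < b then b else 0) := by split_ifs <;> linarith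
    have n1 : 0 ≤ b * exp (-(F z)) := mul_nonneg hb0 (exp_pos _).le
    have n2 : 0 ≤ 2 * |a - b| := by positivity
    have n3 : 0 ≤ R' * |Λk z - F z| := mul_nonneg hR'pos.le (abs_nonneg _)
    rw [hI, Real.enorm_eq_ofReal_abs, Real.enorm_eq_ofReal_abs, ← ENNReal.ofReal_ofNat 2,
      ← ENNReal.ofReal_mul (by norm_num : (0:ℝ) ≤ 2), ← ENNReal.ofReal_mul hR'pos.le,
      ← ENNReal.ofReal_add n1 n2, ← ENNReal.ofReal_add (add_nonneg n1 n2) n3,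
      ← ENNReal.ofReal_add (add_nonneg (add_nonneg n1 n2) n3) hi0]
    refine ENNReal.ofReal_le_ofReal ?_
    have hΨexp : b * Ψ ≤ b * exp (-(F z)) := mul_le_mul_of_nonneg_left (min_le_right _ _) hb0
    linarith
  -- integrate over `C`
  have hm1 : Measurable fun z : E × E => ENNReal.ofReal (f 0 z.1 z.2 * exp (-(F z))) := (hf0m.mul hFm.neg.exp).ennreal_ofReal
  have hm2 : Measurable fun z : E × E => 2 * ‖fseq (φ k) 0 z.1 z.2 - f 0 z.1 z.2‖ₑ :=
    (((hsolk.contDiff_slice 0 le_rfl).continuous.measurable).sub hf0m).enorm.const_mul _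
  have hm3 : Measurable fun z : E × E => ENNReal.ofReal R' * ‖Λk z - F z‖ₑ := (hΛkm.sub hFm).enorm.const_mul _
  have hm12 : Measurable fun z : E × E => ENNReal.ofReal (f 0 z.1 z.2 * exp (-(F z))) +
      2 * ‖fseq (φ k) 0 z.1 z.2 - f 0 z.1 z.2‖ₑ := hm1.add hm2
  have hm123 : Measurable fun z : E × E => ENNReal.ofReal (f 0 z.1 z.2 * exp (-(F z))) +
      2 * ‖fseq (φ k) 0 z.1 z.2 - f 0 z.1 z.2‖ₑ + ENNReal.ofReal R' * ‖Λk z - F z‖ₑ := hm12.add hm3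
  have hSm : MeasurableSet {z : E × E | R' < f 0 z.1 z.2} := measurableSet_lt measurable_const hf0m
  calc ∫⁻ z in C, ENNReal.ofReal (fseq (φ k) 0 z.1 z.2 * exp (-(Λk z))) ∂μ
      ≤ ∫⁻ z in C, (ENNReal.ofReal (f 0 z.1 z.2 * exp (-(F z))) + 2 * ‖fseq (φ k) 0 z.1 z.2 - f 0 z.1 z.2‖ₑ +
          ENNReal.ofReal R' * ‖Λk z - F z‖ₑ +
          {z : E × E | R' < f 0 z.1 z.2}.indicator (fun z => ENNReal.ofReal (f 0 z.1 z.2)) z) ∂μ :=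
        lintegral_mono fun z => hpt z
    _ = (∫⁻ z in C, ENNReal.ofReal (f 0 z.1 z.2 * exp (-(F z))) ∂μ) +
          (∫⁻ z in C, 2 * ‖fseq (φ k) 0 z.1 z.2 - f 0 z.1 z.2‖ₑ ∂μ) +
          (∫⁻ z in C, ENNReal.ofReal R' * ‖Λk z - F z‖ₑ ∂μ) +
          ∫⁻ z in C, {z : E × E | R' < f 0 z.1 z.2}.indicator (fun z => ENNReal.ofReal (f 0 z.1 z.2)) z ∂μ := by
        rw [lintegral_add_left hm123, lintegral_add_left hm12, lintegral_add_left hm1]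
    _ ≤ (∫⁻ z in C, ENNReal.ofReal (f 0 z.1 z.2 * exp (-(F z))) ∂μ) +
          ENNReal.ofReal (ε / 3) + ENNReal.ofReal (ε / 3) + ENNReal.ofReal (ε / 3) := by
        refine add_le_add (add_le_add (add_le_add le_rfl ?_) ?_) ?_
        · refine le_trans ?_ hk1.le
          have hmd : Measurable fun z : E × E => ‖fseq (φ k) 0 z.1 z.2 - f 0 z.1 z.2‖ₑ :=
            (((hsolk.contDiff_slice 0 le_rfl).continuous.measurable).sub hf0m).enorm
          rw [lintegral_const_mul _ hmd]
          exact mul_le_mul' le_rfl (lintegral_mono' Measure.restrict_le_self le_rfl)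
        · refine le_trans ?_ hk2.le
          have hmd : Measurable fun z : E × E => ‖Λk z - F z‖ₑ := (hΛkm.sub hFm).enorm
          rw [lintegral_const_mul _ hmd]
          exact mul_le_mul' le_rfl (lintegral_mono_set hCsub)
        · rw [lintegral_indicator hSm, Measure.restrict_restrict hSm]
          exact (lintegral_mono_set inter_subset_left).trans htail
    _ = _ := by
        rw [add_assoc, add_assoc, ← ENNReal.ofReal_add (by positivity) (by positivity),
          ← ENNReal.ofReal_add (by positivity) (by positivity)]
        congr 2
        ring

end Data


/-! ## The multipliers of the level-truncated Duhamel gain term -/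

section Multiplier

universe u

variable {E : Type u} [NormedAddCommGroup E] [InnerProductSpace ℝ E] [FiniteDimensional ℝ E]
  [MeasurableSpace E] [BorelSpace E]

/-- The level weight `1_{u(s ∨ 0, y, v) ≤ M}` of the tree's level truncation
(`DiPernaLionsGainLevelTruncation`), as a real function on phase space-time (time clamped to
`[0, ∞)` for measurability). [folklore] -/
def levelWeight (M : ℝ) (u : ℝ → E → E → ℝ) (q : ℝ × E × E) : ℝ :=
  if u (max q.1 0) q.2.1 q.2.2 ≤ M then 1 else 0

/-- The sheared Duhamel multiplier
`1_{(0,t)}(s) 1_C(y - s v, v) min(1, e^{-(Λ(t, y - s v, v) - Λ(s, y - s v, v))})` of a damping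
exponent `Λ` along the characteristic through the base point `(y - s v, v)`: integrating a density
at `(s, y, v)` against it gives `∫_C ∫₀ᵗ (density)♯ e^{-(Λ♯(t) - Λ♯(s))} ds` (the operator `T_Λ⁻¹`
of CIP 1994 §5.3 Step 13 tested on the set `C` of characteristics). [cite: CIPDiluteGases1994, §5.3 Step 13 (p. 157)] -/
def duhamelMultiplier (t : ℝ) (C : Set (E × E)) (Λ : ℝ → E → E → ℝ) (q : ℝ × E × E) : ℝ :=
  (Ioo 0 t).indicator (fun _ => (1 : ℝ)) q.1 *
    (C.indicator (fun _ => (1 : ℝ)) (q.2.1 - q.1 • q.2.2, q.2.2) *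
      min 1 (exp (-(Λ t (q.2.1 - q.1 • q.2.2) q.2.2 - Λ q.1 (q.2.1 - q.1 • q.2.2) q.2.2))))

omit [NormedAddCommGroup E] [InnerProductSpace ℝ E] [FiniteDimensional ℝ E] [MeasurableSpace E]
  [BorelSpace E] in
/-- `0 ≤ levelWeight ≤ 1`. [folklore] -/
theorem levelWeight_mem (M : ℝ) (u : ℝ → E → E → ℝ) (q : ℝ × E × E) :
    0 ≤ levelWeight M u q ∧ levelWeight M u q ≤ 1 := by
  unfold levelWeight; split_ifs <;> norm_num

omit [NormedAddCommGroup E] [InnerProductSpace ℝ E] [FiniteDimensional ℝ E] [MeasurableSpace E]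
  [BorelSpace E] in
/-- `levelWeight · u ≤ M` at nonnegative times. [folklore] -/
theorem levelWeight_mul_le {M : ℝ} (hM : 0 ≤ M) (u : ℝ → E → E → ℝ) {q : ℝ × E × E} (hq : 0 ≤ q.1) :
    levelWeight M u q * u q.1 q.2.1 q.2.2 ≤ M := by
  unfold levelWeight
  rw [max_eq_left hq]
  split_ifs with h
  · rwa [one_mul]
  · rwa [zero_mul]

omit [NormedAddCommGroup E] [InnerProductSpace ℝ E] [FiniteDimensional ℝ E] [BorelSpace E] in
/-- Measurability of the level weight of a density measurable after time clamping. [folklore] -/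
theorem measurable_levelWeight (M : ℝ) {u : ℝ → E → E → ℝ}
    (hum : Measurable fun z : ℝ × E × E => u (max z.1 0) z.2.1 z.2.2) : Measurable (levelWeight M u) := by
  unfold levelWeight
  exact Measurable.ite (measurableSet_le hum measurable_const) measurable_const measurable_const

omit [FiniteDimensional ℝ E] [MeasurableSpace E] [BorelSpace E] in
/-- `0 ≤ duhamelMultiplier ≤ 1`. [folklore] -/
theorem duhamelMultiplier_mem (t : ℝ) (C : Set (E × E)) (Λ : ℝ → E → E → ℝ) (q : ℝ × E × E) :
    0 ≤ duhamelMultiplier t C Λ q ∧ duhamelMultiplier t C Λ q ≤ 1 := by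
  unfold duhamelMultiplier
  have h1 : 0 ≤ (Ioo 0 t).indicator (fun _ => (1 : ℝ)) q.1 ∧ (Ioo 0 t).indicator (fun _ => (1 : ℝ)) q.1 ≤ 1 := by
    by_cases h : q.1 ∈ Ioo 0 t <;> simp [h]
  have h2 : 0 ≤ C.indicator (fun _ => (1 : ℝ)) (q.2.1 - q.1 • q.2.2, q.2.2) ∧
      C.indicator (fun _ => (1 : ℝ)) (q.2.1 - q.1 • q.2.2, q.2.2) ≤ 1 := by
    by_cases h : (q.2.1 - q.1 • q.2.2, q.2.2) ∈ C <;> simp [h]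
  have h3 : 0 ≤ min 1 (exp (-(Λ t (q.2.1 - q.1 • q.2.2) q.2.2 - Λ q.1 (q.2.1 - q.1 • q.2.2) q.2.2))) ∧
      min 1 (exp (-(Λ t (q.2.1 - q.1 • q.2.2) q.2.2 - Λ q.1 (q.2.1 - q.1 • q.2.2) q.2.2))) ≤ 1 :=
    ⟨le_min zero_le_one (exp_pos _).le, min_le_left _ _⟩
  constructor
  · exact mul_nonneg h1.1 (mul_nonneg h2.1 h3.1)
  · calc _ ≤ 1 * (1 * 1) := mul_le_mul h1.2 (mul_le_mul h2.2 h3.2 h3.1 zero_le_one) (mul_nonneg h2.1 h3.1) zero_le_one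
      _ = 1 := by ring

omit [FiniteDimensional ℝ E] [MeasurableSpace E] [BorelSpace E] in
/-- The multiplier vanishes unless `s ∈ (0, t)` and the base point lies in `C`. [folklore] -/
theorem mem_of_duhamelMultiplier_ne_zero {t : ℝ} {C : Set (E × E)} {Λ : ℝ → E → E → ℝ} {q : ℝ × E × E}
    (h : duhamelMultiplier t C Λ q ≠ 0) : q.1 ∈ Ioo 0 t ∧ (q.2.1 - q.1 • q.2.2, q.2.2) ∈ C := by
  unfold duhamelMultiplier at h
  constructor
  · by_contra hs; exact h (by rw [indicator_of_notMem hs, zero_mul])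
  · by_contra hz; exact h (by rw [indicator_of_notMem hz, zero_mul, mul_zero])

/-- Measurability of the Duhamel multiplier for a jointly measurable damping exponent and a
measurable set of characteristics. [folklore] -/
theorem measurable_duhamelMultiplier (t : ℝ) {C : Set (E × E)} (hC : MeasurableSet C)
    {Λ : ℝ → E → E → ℝ} (hΛ : Measurable fun a : ℝ × E × E => Λ a.1 a.2.1 a.2.2) :
    Measurable (duhamelMultiplier t C Λ) := by
  unfold duhamelMultiplier
  have hx : Measurable fun q : ℝ × E × E => (q.2.1 - q.1 • q.2.2, q.2.2) :=
    (measurable_snd.fst.sub (measurable_fst.smul measurable_snd.snd)).prodMk measurable_snd.snd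
  have hΛt : Measurable fun q : ℝ × E × E => Λ t (q.2.1 - q.1 • q.2.2) q.2.2 :=
    hΛ.comp (measurable_const.prodMk hx)
  have hΛs : Measurable fun q : ℝ × E × E => Λ q.1 (q.2.1 - q.1 • q.2.2) q.2.2 :=
    hΛ.comp (measurable_fst.prodMk hx)
  exact ((measurable_const.indicator measurableSet_Ioo).comp measurable_fst).mul
    (((measurable_const.indicator hC).comp hx).mul (measurable_const.min (hΛt.sub hΛs).neg.exp))

omit [FiniteDimensional ℝ E] [MeasurableSpace E] [BorelSpace E] in
/-- **The difference of the multipliers**: for `q = (s, y, v)` with `0 ≤ s ≤ t` and a damping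
exponent `Λ` monotone along the characteristic, `Mₖ - M ≤ min(1, |ΔΛ - ΔF|)` where
`ΔΛ = Λ(t) - Λ(s) ≥ 0` and `ΔF = F(t) - F(s)` at the base point (`exp_neg_le_min_add_min`). [folklore] -/
theorem duhamelMultiplier_sub_le {t : ℝ} (C : Set (E × E)) {Λ F : ℝ → E → E → ℝ} {q : ℝ × E × E}
    (hΛ : Λ q.1 (q.2.1 - q.1 • q.2.2) q.2.2 ≤ Λ t (q.2.1 - q.1 • q.2.2) q.2.2) :
    duhamelMultiplier t C Λ q - duhamelMultiplier t C F q ≤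
      min 1 |(Λ t (q.2.1 - q.1 • q.2.2) q.2.2 - Λ q.1 (q.2.1 - q.1 • q.2.2) q.2.2) -
        (F t (q.2.1 - q.1 • q.2.2) q.2.2 - F q.1 (q.2.1 - q.1 • q.2.2) q.2.2)| := by
  set a := Λ t (q.2.1 - q.1 • q.2.2) q.2.2 - Λ q.1 (q.2.1 - q.1 • q.2.2) q.2.2 with ha
  set b := F t (q.2.1 - q.1 • q.2.2) q.2.2 - F q.1 (q.2.1 - q.1 • q.2.2) q.2.2 with hb
  have ha0 : 0 ≤ a := sub_nonneg.2 hΛ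
  have hm0 : 0 ≤ min 1 |a - b| := le_min zero_le_one (abs_nonneg _)
  unfold duhamelMultiplier
  rw [← ha, ← hb]
  by_cases hs : q.1 ∈ Ioo 0 t
  · by_cases hz : (q.2.1 - q.1 • q.2.2, q.2.2) ∈ C
    · rw [indicator_of_mem hs, indicator_of_mem hz, one_mul, one_mul, one_mul, one_mul]
      have hea : min 1 (exp (-a)) = exp (-a) := min_eq_right (by rw [exp_le_one_iff]; linarith)
      rw [hea]
      linarith [exp_neg_le_min_add_min (b := b) ha0]
    · simp only [indicator_of_notMem hz, zero_mul, mul_zero, sub_self]; exact hm0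
  · simp only [indicator_of_notMem hs, zero_mul, sub_self]; exact hm0

end Multiplier


/-! ## The multiplier error of the level-truncated Duhamel gain term -/

section MultiplierError

universe u

variable {E : Type u} [NormedAddCommGroup E] [InnerProductSpace ℝ E] [FiniteDimensional ℝ E]
  [MeasurableSpace E] [BorelSpace E]

variable {B : E × E → sphere (0 : E) 1 → ℝ} {f₀ : E → E → ℝ} {δ : ℕ → ℝ}
  {Bseq : ℕ → E × E → sphere (0 : E) 1 → ℝ} {fseq : ℕ → ℝ → E → E → ℝ} {φ : ℕ → ℕ}
  {f : ℝ → E → E → ℝ}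

/-- **The damping exponents converge along sheared characteristics, integrated in time**:
`∫_{E × B̄_R} ∫₀ᵗ |(Λₖ♯(t) - Λₖ♯(s)) - (F♯(t) - F♯(s))| ds ≤ 2 t ∫_{(0,t) × E × B̄_R} |λₖ - λ|`
(`DiPernaLionsDampingLimit.lintegral_enorm_truncatedDampingExponent_sub_le` at the two times). [cite: CIPDiluteGases1994, §5.3 Step 13 (p. 157)] -/
theorem lintegral_lintegral_enorm_dampingIncrement_sub_le (hB : IsDiPernaLionsKernel B)
    (hf₀ : HasDiPernaLionsData f₀) (hδ : ∀ n, 0 < δ n) (hanti : Antitone δ)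
    (hlim : Tendsto δ atTop (𝓝 0)) (hker : IsDiPernaLionsKernelApproximation B Bseq)
    (hdata : IsDiPernaLionsDataApproximation f₀ (fun n => fseq n 0))
    (hsol : ∀ n, IsDiPernaLionsApproximateSolution (δ n) (Bseq n) (fseq n))
    (hbd : UniformDiPernaLionsBounds δ Bseq fseq) (hW : IsDiPernaLionsWeakLimit f₀ fseq φ f) {t : ℝ}
    (ht : 0 ≤ t) (R : ℝ) (n : ℕ) :
    ∫⁻ z in univ ×ˢ closedBall (0 : E) R, (∫⁻ s in Ioo 0 t,
        ‖(truncatedDampingExponent (δ n) (Bseq n) (fseq n) t z.1 z.2 -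
            truncatedDampingExponent (δ n) (Bseq n) (fseq n) s z.1 z.2) -
          (dampingExponent B f t z.1 z.2 - dampingExponent B f s z.1 z.2)‖ₑ) ∂((volume : Measure E).prod volume) ≤
      2 * ENNReal.ofReal t * ∫⁻ q in Ioo 0 t ×ˢ (univ ×ˢ closedBall (0 : E) R),
        ‖truncatedCollisionFrequency (δ n) (Bseq n) (fseq n) q.1 q.2.1 q.2.2 -
          DiPernaLionsMildLimit.collisionFrequency B f q.1 q.2.1 q.2.2‖ₑ ∂(volume : Measure (ℝ × E × E)) := by
  set μ : Measure (E × E) := ((volume : Measure E).prod volume).restrict (univ ×ˢ closedBall (0 : E) R) with hμ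
  set Λ : ℝ → E × E → ℝ := fun s z => truncatedDampingExponent (δ n) (Bseq n) (fseq n) s z.1 z.2 with hΛ
  set F : ℝ → E × E → ℝ := fun s z => dampingExponent B f s z.1 z.2 with hF
  set D : ℝ≥0∞ := ∫⁻ q in Ioo 0 t ×ˢ (univ ×ˢ closedBall (0 : E) R),
    ‖truncatedCollisionFrequency (δ n) (Bseq n) (fseq n) q.1 q.2.1 q.2.2 -
      DiPernaLionsMildLimit.collisionFrequency B f q.1 q.2.1 q.2.2‖ₑ ∂(volume : Measure (ℝ × E × E)) with hD
  have hd : ∀ s ∈ Icc 0 t, ∫⁻ z, ‖Λ s z - F s z‖ₑ ∂μ ≤ D := fun s hs =>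
    lintegral_enorm_truncatedDampingExponent_sub_le hB hf₀ hδ hanti hlim hker hdata hsol hbd hW hs R n
  have hΛm : Measurable fun p : ℝ × (E × E) => Λ p.1 p.2 :=
    ((hsol n).measurable_truncatedDampingExponent (hker.isDiPernaLionsKernel n).measurable).comp
      (measurable_fst.prodMk (measurable_snd.fst.prodMk measurable_snd.snd))
  have hFm : Measurable fun p : ℝ × (E × E) => F p.1 p.2 :=
    (measurable_dampingExponent hB.measurable hW.measurable).comp
      (measurable_fst.prodMk (measurable_snd.fst.prodMk measurable_snd.snd))
  have hdm : Measurable fun p : ℝ × (E × E) => ‖Λ p.1 p.2 - F p.1 p.2‖ₑ := (hΛm.sub hFm).enorm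
  -- pointwise triangle inequality and integration
  have hpt : ∀ z s, ‖(Λ t z - Λ s z) - (F t z - F s z)‖ₑ ≤ ‖Λ t z - F t z‖ₑ + ‖Λ s z - F s z‖ₑ := by
    intro z s
    rw [show (Λ t z - Λ s z) - (F t z - F s z) = (Λ t z - F t z) - (Λ s z - F s z) by ring]
    exact enorm_sub_le
  have hm_s : ∀ z, Measurable fun s => ‖Λ s z - F s z‖ₑ := fun z => hdm.comp (measurable_id.prodMk measurable_const)
  calc ∫⁻ z, (∫⁻ s in Ioo 0 t, ‖(Λ t z - Λ s z) - (F t z - F s z)‖ₑ) ∂μ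
      ≤ ∫⁻ z, (∫⁻ s in Ioo 0 t, (‖Λ t z - F t z‖ₑ + ‖Λ s z - F s z‖ₑ)) ∂μ :=
        lintegral_mono fun z => lintegral_mono fun s => hpt z s
    _ = ∫⁻ z, (ENNReal.ofReal t * ‖Λ t z - F t z‖ₑ + ∫⁻ s in Ioo 0 t, ‖Λ s z - F s z‖ₑ) ∂μ := by
        refine lintegral_congr fun z => ?_
        rw [lintegral_add_right _ (hm_s z), setLIntegral_const, Real.volume_Ioo, sub_zero, mul_comm]
    _ = ENNReal.ofReal t * ∫⁻ z, ‖Λ t z - F t z‖ₑ ∂μ + ∫⁻ z, (∫⁻ s in Ioo 0 t, ‖Λ s z - F s z‖ₑ) ∂μ := by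
        have hm0 : Measurable fun z : E × E => ‖Λ t z - F t z‖ₑ := hdm.comp (measurable_const.prodMk measurable_id)
        have hm1 : Measurable fun z : E × E => ENNReal.ofReal t * ‖Λ t z - F t z‖ₑ := hm0.const_mul _
        rw [lintegral_add_left hm1, lintegral_const_mul _ hm0]
    _ = ENNReal.ofReal t * ∫⁻ z, ‖Λ t z - F t z‖ₑ ∂μ + ∫⁻ s in Ioo 0 t, (∫⁻ z, ‖Λ s z - F s z‖ₑ ∂μ) := by
        congr 1
        exact lintegral_lintegral_swap ((hdm.comp (measurable_snd.prodMk measurable_fst)).aemeasurable)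
    _ ≤ ENNReal.ofReal t * D + ∫⁻ s in Ioo 0 t, D := by
        refine add_le_add (mul_le_mul' le_rfl (hd t ⟨ht, le_rfl⟩)) (setLIntegral_mono' measurableSet_Ioo fun s hs => ?_)
        exact hd s ⟨hs.1.le, hs.2.le⟩
    _ = 2 * ENNReal.ofReal t * D := by
        rw [setLIntegral_const, Real.volume_Ioo, sub_zero]; ring

/-- **The multiplier error of the level-truncated Duhamel gain term vanishes in the limit**: with
`wₖ = 1_{f^{φ(k)} ≤ M}`, the multipliers `Mₖ` (damping `Λₖ`) and `M` (damping `F`) of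
`duhamelMultiplier`, and the normalised gains `R̃ₖ = (1 + δₖ∫f^{φ(k)})⁻¹ Q₊^{φ(k)}`, eventually
`∫ wₖ (Mₖ - M) R̃ₖ ≤ ε`: `wₖ R̃ₖ ≤ (1 + M) R̃ₖ/(1 + f^{φ(k)})` is equi-integrable on
`(0,t) × E × B̄_{R_v}` (CIP Lemma 5.3.7) and `0 ≤ (Mₖ - M)₊ ≤ min(1, |ΔΛₖ - ΔF|) → 0` in measure there
(`lintegral_lintegral_enorm_dampingIncrement_sub_le` and the convergence of the collision
frequencies, CIP Lemma 5.3.11 ii)). [cite: CIPDiluteGases1994, §5.3 Lemma 5.3.7 (p. 148), Lemma 5.3.11 ii) (p. 155)] -/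
theorem eventually_lintegral_levelCut_diff_le (hB : IsDiPernaLionsKernel B)
    (hf₀ : HasDiPernaLionsData f₀) (hδ : ∀ n, 0 < δ n) (hanti : Antitone δ)
    (hlim : Tendsto δ atTop (𝓝 0)) (hker : IsDiPernaLionsKernelApproximation B Bseq)
    (hdata : IsDiPernaLionsDataApproximation f₀ (fun n => fseq n 0))
    (hsol : ∀ n, IsDiPernaLionsApproximateSolution (δ n) (Bseq n) (fseq n))
    (hbd : UniformDiPernaLionsBounds δ Bseq fseq) (hW : IsDiPernaLionsWeakLimit f₀ fseq φ f) {t : ℝ}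
    (ht : 0 < t) {C : Set (E × E)} {Rv : ℝ}
    (hCsub : C ⊆ univ ×ˢ closedBall (0 : E) Rv) {M : ℝ} (hM : 0 ≤ M) {ε : ℝ} (hε : 0 < ε) :
    ∀ᶠ k in atTop, ∫⁻ q, ENNReal.ofReal (levelWeight M (fseq (φ k)) q *
        (duhamelMultiplier t C (truncatedDampingExponent (δ (φ k)) (Bseq (φ k)) (fseq (φ k))) q -
          duhamelMultiplier t C (dampingExponent B f) q)) *
        (ENNReal.ofReal ((1 + δ (φ k) * ∫ ξ, |fseq (φ k) q.1 q.2.1 ξ|)⁻¹) *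
          eGain (Bseq (φ k)) (fseq (φ k)) q) ∂(volume : Measure (ℝ × E × E)) ≤ ENNReal.ofReal ε := by
  set box : Set (ℝ × E × E) := Ioo 0 t ×ˢ (univ ×ˢ closedBall (0 : E) Rv) with hbox
  have hboxm : MeasurableSet box := measurableSet_Ioo.prod (MeasurableSet.univ.prod measurableSet_closedBall)
  set μb : Measure (ℝ × E × E) := (volume : Measure (ℝ × E × E)).restrict box with hμb
  -- the equi-integrable family of Lemma 5.3.7 along `φ`
  set G : ℕ → ℝ × E × E → ℝ := fun n z => (1 + δ n * ∫ w, |fseq n z.1 z.2.1 w|)⁻¹ *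
    gainWith (Bseq n) (fseq n z.1 z.2.1) (fseq n z.1 z.2.1) z.2.2 / (1 + fseq n z.1 z.2.1 z.2.2) with hG
  obtain ⟨⟨hUI, -⟩, -⟩ := diPernaLions_approx_collisionTerms_weaklyCompact_holds hB hf₀ hδ hanti hlim hker
    hdata hsol hbd t Rv
  have hU : UniformIntegrable (G ∘ φ) 1 μb := uniformIntegrable_comp_subseq hUI φ
  obtain ⟨Cb, hCb⟩ := hU.2.2
  -- constants
  set A : ℝ := 1 + M with hA
  have hApos : 0 < A := by rw [hA]; linarith
  set ε₁ : ℝ := ε / (2 * A) with hε₁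
  have hε₁pos : 0 < ε₁ := by positivity
  set η : ℝ := ε / (2 * A * ((Cb : ℝ) + 1)) with hη
  have hηpos : 0 < η := by positivity
  obtain ⟨δ', hδ', hδ'UI⟩ := hU.2.1 hε₁pos
  -- `Dₖ → 0`
  have hDlim := tendsto_lintegral_box_normalisedFrequency_sub velocityAverage_relativelyCompact_L1_holds hB hf₀
    hδ hanti hlim hker hdata hsol hbd hW t Rv
  have hDlim' : Tendsto (fun k => (ENNReal.ofReal η)⁻¹ * ((2 * ENNReal.ofReal t) *
      ∫⁻ q in Ioo 0 t ×ˢ (univ ×ˢ closedBall (0 : E) Rv),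
        ‖truncatedCollisionFrequency (δ (φ k)) (Bseq (φ k)) (fseq (φ k)) q.1 q.2.1 q.2.2 -
          DiPernaLionsMildLimit.collisionFrequency B f q.1 q.2.1 q.2.2‖ₑ ∂(volume : Measure (ℝ × E × E)))) atTop (𝓝 0) := by
    have h1 := ENNReal.Tendsto.const_mul hDlim (Or.inr (ENNReal.mul_ne_top (by simp) ENNReal.ofReal_ne_top))
      (a := 2 * ENNReal.ofReal t)
    rw [mul_zero] at h1
    have h2 := ENNReal.Tendsto.const_mul h1 (Or.inr (ENNReal.inv_ne_top.2 (ENNReal.ofReal_pos.2 hηpos).ne'))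
      (a := (ENNReal.ofReal η)⁻¹)
    rw [mul_zero] at h2
    exact h2
  have hev := hDlim'.eventually (gt_mem_nhds (ENNReal.ofReal_pos.2 hδ'))
  filter_upwards [hev] with k hk
  -- ### the estimate at level `k`
  have hsolk := hsol (φ k)
  have hBk := hker.isDiPernaLionsKernel (φ k)
  obtain ⟨Cbk, hCbk⟩ := hker.bounded (φ k)
  obtain ⟨Rbk, hRbk⟩ := hker.eq_zero_of_le (φ k)
  set Λk : ℝ → E → E → ℝ := truncatedDampingExponent (δ (φ k)) (Bseq (φ k)) (fseq (φ k)) with hΛk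
  set F : ℝ → E → E → ℝ := dampingExponent B f with hF
  have hΛkm : Measurable fun a : ℝ × E × E => Λk a.1 a.2.1 a.2.2 :=
    hsolk.measurable_truncatedDampingExponent hBk.measurable
  have hFm : Measurable fun a : ℝ × E × E => F a.1 a.2.1 a.2.2 := measurable_dampingExponent hB.measurable hW.measurable
  -- the distance of the increments
  set dk : ℝ × E × E → ℝ := fun q => min 1 |(Λk t (q.2.1 - q.1 • q.2.2) q.2.2 - Λk q.1 (q.2.1 - q.1 • q.2.2) q.2.2) -
    (F t (q.2.1 - q.1 • q.2.2) q.2.2 - F q.1 (q.2.1 - q.1 • q.2.2) q.2.2)| with hdk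
  have hdk01 : ∀ q, 0 ≤ dk q ∧ dk q ≤ 1 := fun q => ⟨le_min zero_le_one (abs_nonneg _), min_le_left _ _⟩
  have hx : Measurable fun q : ℝ × E × E => (q.2.1 - q.1 • q.2.2, q.2.2) :=
    (measurable_snd.fst.sub (measurable_fst.smul measurable_snd.snd)).prodMk measurable_snd.snd
  have hhm : Measurable fun q : ℝ × E × E => (Λk t (q.2.1 - q.1 • q.2.2) q.2.2 - Λk q.1 (q.2.1 - q.1 • q.2.2) q.2.2) -
      (F t (q.2.1 - q.1 • q.2.2) q.2.2 - F q.1 (q.2.1 - q.1 • q.2.2) q.2.2) :=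
    ((hΛkm.comp (measurable_const.prodMk hx)).sub (hΛkm.comp (measurable_fst.prodMk hx))).sub
      ((hFm.comp (measurable_const.prodMk hx)).sub (hFm.comp (measurable_fst.prodMk hx)))
  have hdkm : Measurable dk := measurable_const.min hhm.abs
  -- the level weight and its domination by the equi-integrable family
  have hgm : Measurable fun z : ℝ × E × E => fseq (φ k) (max z.1 0) z.2.1 z.2.2 := by
    have hc : Continuous fun z : ℝ × E × E => ((max z.1 0, z.2) : ℝ × E × E) :=
      (continuous_fst.max continuous_const).prodMk continuous_snd
    exact (hsolk.continuousOn_uncurry.comp_continuous hc fun z =>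
      mk_mem_prod (mem_Ici.2 (le_max_right _ _)) (mem_univ _)).measurable
  have hwm : Measurable (levelWeight M (fseq (φ k))) := measurable_levelWeight M hgm
  -- ### step 1: the pointwise bound
  have hpt : ∀ q : ℝ × E × E, ENNReal.ofReal (levelWeight M (fseq (φ k)) q *
        (duhamelMultiplier t C Λk q - duhamelMultiplier t C F q)) *
        (ENNReal.ofReal ((1 + δ (φ k) * ∫ ξ, |fseq (φ k) q.1 q.2.1 ξ|)⁻¹) * eGain (Bseq (φ k)) (fseq (φ k)) q) ≤
      ENNReal.ofReal A * box.indicator (fun q => ENNReal.ofReal (dk q) * ENNReal.ofReal ((G ∘ φ) k q)) q := by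
    intro q
    by_cases hD : duhamelMultiplier t C Λk q - duhamelMultiplier t C F q ≤ 0
    · rw [ENNReal.ofReal_of_nonpos (mul_nonpos_of_nonneg_of_nonpos (levelWeight_mem M _ q).1 hD), zero_mul]
      exact bot_le
    rw [not_le] at hD
    have hne : duhamelMultiplier t C Λk q ≠ 0 := by
      intro h0; rw [h0] at hD; linarith [(duhamelMultiplier_mem t C F q).1]
    obtain ⟨hs, hz⟩ := mem_of_duhamelMultiplier_ne_zero hne
    have hqbox : q ∈ box := by
      refine ⟨hs, mem_univ _, ?_⟩
      exact (mem_prod.1 (hCsub hz)).2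
    rw [indicator_of_mem hqbox]
    -- `Mₖ - M ≤ dₖ`
    have hmono : Λk q.1 (q.2.1 - q.1 • q.2.2) q.2.2 ≤ Λk t (q.2.1 - q.1 • q.2.2) q.2.2 :=
      hsolk.truncatedDampingExponent_mono hBk.measurable hBk.nonneg hCbk (hδ _).le _ _ hs.1.le hs.2.le
    have hDd : duhamelMultiplier t C Λk q - duhamelMultiplier t C F q ≤ dk q := duhamelMultiplier_sub_le C hmono
    -- the gain term is real at positive times
    obtain ⟨hfin, hgain⟩ := hsolk.gainWith_eq_toReal_eGain_slice hBk hCbk hRbk hs.1.le q.2.1 q.2.2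
    set a : ℝ := (1 + δ (φ k) * ∫ ξ, |fseq (φ k) q.1 q.2.1 ξ|)⁻¹ with ha
    have ha01 : 0 ≤ a ∧ a ≤ 1 := by
      have hm0 : 0 ≤ ∫ ξ, |fseq (φ k) q.1 q.2.1 ξ| := integral_nonneg fun _ => abs_nonneg _
      have h1 : 1 ≤ 1 + δ (φ k) * ∫ ξ, |fseq (φ k) q.1 q.2.1 ξ| := by nlinarith [(hδ (φ k)).le]
      exact ⟨inv_nonneg.2 (by linarith), inv_le_one_of_one_le₀ h1⟩
    have hfq : 0 ≤ fseq (φ k) q.1 q.2.1 q.2.2 := hsolk.nonneg _ hs.1.le _ _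
    have hGW0 : 0 ≤ gainWith (Bseq (φ k)) (fseq (φ k) q.1 q.2.1) (fseq (φ k) q.1 q.2.1) q.2.2 := by
      rw [hgain]; exact ENNReal.toReal_nonneg
    have hGq : (G ∘ φ) k q = a * gainWith (Bseq (φ k)) (fseq (φ k) q.1 q.2.1) (fseq (φ k) q.1 q.2.1) q.2.2 /
        (1 + fseq (φ k) q.1 q.2.1 q.2.2) := rfl
    have hG0 : 0 ≤ (G ∘ φ) k q := by rw [hGq]; exact div_nonneg (mul_nonneg ha01.1 hGW0) (by linarith)
    set w : ℝ := levelWeight M (fseq (φ k)) q with hw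
    have hw01 := levelWeight_mem M (fseq (φ k)) q
    have hwf : w * fseq (φ k) q.1 q.2.1 q.2.2 ≤ M := levelWeight_mul_le hM (fseq (φ k)) hs.1.le
    -- everything real
    have heG : eGain (Bseq (φ k)) (fseq (φ k)) q =
        ENNReal.ofReal (gainWith (Bseq (φ k)) (fseq (φ k) q.1 q.2.1) (fseq (φ k) q.1 q.2.1) q.2.2) := by
      rw [hgain, ENNReal.ofReal_toReal hfin.ne]
    rw [heG, ← ENNReal.ofReal_mul ha01.1, ← ENNReal.ofReal_mul (mul_nonneg hw01.1 hD.le),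
      Function.comp_apply, ← ENNReal.ofReal_mul (hdk01 q).1, ← ENNReal.ofReal_mul hApos.le]
    refine ENNReal.ofReal_le_ofReal ?_
    have hkey : w * (a * gainWith (Bseq (φ k)) (fseq (φ k) q.1 q.2.1) (fseq (φ k) q.1 q.2.1) q.2.2) ≤ A * G (φ k) q := by
      have hw1f : w * (1 + fseq (φ k) q.1 q.2.1 q.2.2) ≤ A := by rw [hA]; nlinarith [hw01.2]
      have hpos : 0 < 1 + fseq (φ k) q.1 q.2.1 q.2.2 := by linarith
      have hGq' : G (φ k) q = a * gainWith (Bseq (φ k)) (fseq (φ k) q.1 q.2.1) (fseq (φ k) q.1 q.2.1) q.2.2 /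
          (1 + fseq (φ k) q.1 q.2.1 q.2.2) := rfl
      rw [hGq']
      have heq : w * (a * gainWith (Bseq (φ k)) (fseq (φ k) q.1 q.2.1) (fseq (φ k) q.1 q.2.1) q.2.2) =
          (w * (1 + fseq (φ k) q.1 q.2.1 q.2.2)) * (a * gainWith (Bseq (φ k)) (fseq (φ k) q.1 q.2.1)
            (fseq (φ k) q.1 q.2.1) q.2.2 / (1 + fseq (φ k) q.1 q.2.1 q.2.2)) := by
        rw [mul_div_assoc', eq_div_iff hpos.ne']; ring
      rw [heq]
      exact mul_le_mul_of_nonneg_right hw1f (div_nonneg (mul_nonneg ha01.1 hGW0) hpos.le)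
    calc w * (duhamelMultiplier t C Λk q - duhamelMultiplier t C F q) *
          (a * gainWith (Bseq (φ k)) (fseq (φ k) q.1 q.2.1) (fseq (φ k) q.1 q.2.1) q.2.2)
        = (duhamelMultiplier t C Λk q - duhamelMultiplier t C F q) *
            (w * (a * gainWith (Bseq (φ k)) (fseq (φ k) q.1 q.2.1) (fseq (φ k) q.1 q.2.1) q.2.2)) := by ring
      _ ≤ dk q * (A * G (φ k) q) :=
          mul_le_mul hDd hkey (mul_nonneg hw01.1 (mul_nonneg ha01.1 hGW0)) (hdk01 q).1
      _ = A * (dk q * G (φ k) q) := by ring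
  -- ### step 2: integrate and split at height `η`
  set Ak : Set (ℝ × E × E) := {q | η < dk q} with hAk
  have hAkm : MeasurableSet Ak := measurableSet_lt measurable_const hdkm
  have hsplit : ∀ q, ENNReal.ofReal (dk q) * ENNReal.ofReal ((G ∘ φ) k q) ≤
      ‖Ak.indicator ((G ∘ φ) k) q‖ₑ + ENNReal.ofReal η * ‖(G ∘ φ) k q‖ₑ := by
    intro q
    by_cases hq : q ∈ Ak
    · rw [indicator_of_mem hq]
      calc ENNReal.ofReal (dk q) * ENNReal.ofReal ((G ∘ φ) k q) ≤ 1 * ‖(G ∘ φ) k q‖ₑ :=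
            mul_le_mul' (ENNReal.ofReal_le_one.2 (hdk01 q).2) (Real.ofReal_le_enorm _)
        _ = ‖(G ∘ φ) k q‖ₑ := one_mul _
        _ ≤ _ := le_self_add
    · rw [indicator_of_notMem hq, enorm_zero, zero_add]
      have hle : dk q ≤ η := not_lt.1 hq
      exact mul_le_mul' (ENNReal.ofReal_le_ofReal hle) (Real.ofReal_le_enorm _)
  have hGm : AEStronglyMeasurable ((G ∘ φ) k) μb := hU.1 k
  -- the measure of `Aₖ ∩ box`
  have hμAk : μb Ak ≤ ENNReal.ofReal δ' := by
    have h1 : μb Ak ≤ μb {q | ENNReal.ofReal η ≤ ENNReal.ofReal (dk q)} := by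
      refine measure_mono fun q hq => ?_
      exact ENNReal.ofReal_le_ofReal (le_of_lt hq)
    refine h1.trans ((meas_ge_le_lintegral_div hdkm.ennreal_ofReal.aemeasurable
      (ENNReal.ofReal_pos.2 hηpos).ne' ENNReal.ofReal_ne_top).trans ?_)
    rw [ENNReal.div_eq_inv_mul]
    refine le_trans (mul_le_mul' le_rfl ?_) hk.le
    -- `∫_{box} dₖ ≤ ∫∫ |ΔΛₖ - ΔF| ≤ 2 t Dₖ`
    have h2 : ∫⁻ q, ENNReal.ofReal (dk q) ∂μb ≤ ∫⁻ q in box, ‖(Λk t (q.2.1 - q.1 • q.2.2) q.2.2 -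
        Λk q.1 (q.2.1 - q.1 • q.2.2) q.2.2) - (F t (q.2.1 - q.1 • q.2.2) q.2.2 - F q.1 (q.2.1 - q.1 • q.2.2) q.2.2)‖ₑ
          ∂(volume : Measure (ℝ × E × E)) := by
      refine lintegral_mono fun q => ?_
      rw [Real.enorm_eq_ofReal_abs]
      exact ENNReal.ofReal_le_ofReal (min_le_right _ _)
    refine h2.trans ?_
    -- rewrite as the sheared double integral
    have h3 : ∫⁻ q in box, ‖(Λk t (q.2.1 - q.1 • q.2.2) q.2.2 - Λk q.1 (q.2.1 - q.1 • q.2.2) q.2.2) -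
        (F t (q.2.1 - q.1 • q.2.2) q.2.2 - F q.1 (q.2.1 - q.1 • q.2.2) q.2.2)‖ₑ ∂(volume : Measure (ℝ × E × E)) =
        ∫⁻ z in univ ×ˢ closedBall (0 : E) Rv, (∫⁻ s in Ioo 0 t,
          ‖(Λk t z.1 z.2 - Λk s z.1 z.2) - (F t z.1 z.2 - F s z.1 z.2)‖ₑ) ∂((volume : Measure E).prod volume) := by
      have hL := setLIntegral_lintegral_Ioo_sharp_eq (H := fun q : ℝ × E × E => ‖(Λk t (q.2.1 - q.1 • q.2.2) q.2.2 -
        Λk q.1 (q.2.1 - q.1 • q.2.2) q.2.2) - (F t (q.2.1 - q.1 • q.2.2) q.2.2 - F q.1 (q.2.1 - q.1 • q.2.2) q.2.2)‖ₑ)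
        hhm.enorm (MeasurableSet.univ.prod (measurableSet_closedBall (x := (0 : E)) (ε := Rv))) t
      simp only [add_sub_cancel_right] at hL
      rw [hL, ← lintegral_indicator hboxm]
      · refine lintegral_congr fun q => ?_
        by_cases hq : q ∈ box
        · have hs : q.1 ∈ Ioo 0 t := hq.1
          have hv : (q.2.1 - q.1 • q.2.2, q.2.2) ∈ (univ : Set E) ×ˢ closedBall (0 : E) Rv :=
            ⟨mem_univ _, hq.2.2⟩
          rw [indicator_of_mem hq, indicator_of_mem hs, indicator_of_mem hv, one_mul, one_mul]
        · rw [indicator_of_notMem hq]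
          by_cases hs : q.1 ∈ Ioo 0 t
          · have hv : (q.2.1 - q.1 • q.2.2, q.2.2) ∉ (univ : Set E) ×ˢ closedBall (0 : E) Rv := by
              intro hv; exact hq ⟨hs, mem_univ _, hv.2⟩
            rw [indicator_of_notMem hv, zero_mul, mul_zero]
          · rw [indicator_of_notMem hs, zero_mul]
    rw [h3]
    exact lintegral_lintegral_enorm_dampingIncrement_sub_le hB hf₀ hδ hanti hlim hker hdata hsol hbd hW ht.le Rv (φ k)
  -- ### step 3: conclusion
  have hint1 : ∫⁻ q, ‖Ak.indicator ((G ∘ φ) k) q‖ₑ ∂μb ≤ ENNReal.ofReal ε₁ := by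
    have h := hδ'UI k Ak hAkm hμAk
    rwa [eLpNorm_one_eq_lintegral_enorm] at h
  have hint2 : ∫⁻ q, ‖(G ∘ φ) k q‖ₑ ∂μb ≤ Cb := by
    have h := hCb k
    rwa [eLpNorm_one_eq_lintegral_enorm] at h
  calc ∫⁻ q, ENNReal.ofReal (levelWeight M (fseq (φ k)) q *
          (duhamelMultiplier t C Λk q - duhamelMultiplier t C F q)) *
          (ENNReal.ofReal ((1 + δ (φ k) * ∫ ξ, |fseq (φ k) q.1 q.2.1 ξ|)⁻¹) * eGain (Bseq (φ k)) (fseq (φ k)) q)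
      ≤ ∫⁻ q, ENNReal.ofReal A * box.indicator (fun q => ENNReal.ofReal (dk q) * ENNReal.ofReal ((G ∘ φ) k q)) q :=
        lintegral_mono hpt
    _ = ENNReal.ofReal A * ∫⁻ q, ENNReal.ofReal (dk q) * ENNReal.ofReal ((G ∘ φ) k q) ∂μb := by
        rw [lintegral_const_mul' _ _ ENNReal.ofReal_ne_top, lintegral_indicator hboxm]
    _ ≤ ENNReal.ofReal A * ∫⁻ q, (‖Ak.indicator ((G ∘ φ) k) q‖ₑ + ENNReal.ofReal η * ‖(G ∘ φ) k q‖ₑ) ∂μb :=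
        mul_le_mul' le_rfl (lintegral_mono hsplit)
    _ = ENNReal.ofReal A * (∫⁻ q, ‖Ak.indicator ((G ∘ φ) k) q‖ₑ ∂μb + ENNReal.ofReal η * ∫⁻ q, ‖(G ∘ φ) k q‖ₑ ∂μb) := by
        rw [lintegral_add_left' ((hGm.indicator hAkm).enorm), lintegral_const_mul'' _ hGm.enorm]
    _ ≤ ENNReal.ofReal A * (ENNReal.ofReal ε₁ + ENNReal.ofReal η * Cb) :=
        mul_le_mul' le_rfl (add_le_add hint1 (mul_le_mul' le_rfl hint2))
    _ ≤ ENNReal.ofReal ε := by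
        rw [← ENNReal.ofReal_coe_nnreal, ← ENNReal.ofReal_mul hηpos.le, ← ENNReal.ofReal_add hε₁pos.le (by positivity),
          ← ENNReal.ofReal_mul hApos.le]
        refine ENNReal.ofReal_le_ofReal ?_
        have h1 : A * ε₁ = ε / 2 := by rw [hε₁]; field_simp
        have h2 : A * (η * Cb) ≤ ε / 2 := by
          rw [hη]
          have hc : (0 : ℝ) ≤ Cb := Cb.2
          rw [show A * (ε / (2 * A * ((Cb : ℝ) + 1)) * Cb) = (ε / 2) * (Cb / (Cb + 1)) by field_simp]
          exact mul_le_of_le_one_right (by positivity) ((div_le_one (by linarith)).2 (by linarith))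
        nlinarith

end MultiplierError


/-! ## The subsolution inequality -/

section Subsolution

universe u

variable {E : Type u} [NormedAddCommGroup E] [InnerProductSpace ℝ E] [FiniteDimensional ℝ E]
  [MeasurableSpace E] [BorelSpace E]

variable {B : E × E → sphere (0 : E) 1 → ℝ} {f₀ : E → E → ℝ} {δ : ℕ → ℝ}
  {Bseq : ℕ → E × E → sphere (0 : E) 1 → ℝ} {fseq : ℕ → ℝ → E → E → ℝ} {φ : ℕ → ℕ}
  {f : ℝ → E → E → ℝ}

/-- **The tested limit multiplier reproduces the damped gain primitive**: with
`Φ = duhamelMultiplier t C F` for the limit damping `F`,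
`∫ Φ Q₊_B(f,f) ≤ ∫_C (T_F⁻¹Q₊(f,f))♯(t)` (`eDampedGainPrimitive`; Tonelli and the shear, `min(1, ·) ≤ ·`,
`(0,t) ⊆ (0,t]`). [cite: CIPDiluteGases1994, §5.3 Step 13 (p. 157)] -/
theorem lintegral_duhamelMultiplier_eGain_le (hBm : Measurable (Function.uncurry B))
    (hfm : Measurable fun z : ℝ × E × E => f z.1 z.2.1 z.2.2) (t : ℝ) {C : Set (E × E)} (hC : MeasurableSet C) :
    ∫⁻ q, ENNReal.ofReal (duhamelMultiplier t C (dampingExponent B f) q) * eGain B f q ∂(volume : Measure (ℝ × E × E)) ≤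
      ∫⁻ z in C, eDampedGainPrimitive B f t z.1 z.2 ∂((volume : Measure E).prod volume) := by
  set F : ℝ → E → E → ℝ := dampingExponent B f with hF
  have hFm : Measurable fun a : ℝ × E × E => F a.1 a.2.1 a.2.2 := measurable_dampingExponent hBm hfm
  have hx : Measurable fun q : ℝ × E × E => (q.2.1 - q.1 • q.2.2, q.2.2) :=
    (measurable_snd.fst.sub (measurable_fst.smul measurable_snd.snd)).prodMk measurable_snd.snd
  set H : ℝ × E × E → ℝ≥0∞ := fun q => ENNReal.ofReal (min 1 (exp (-(F t (q.2.1 - q.1 • q.2.2) q.2.2 -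
    F q.1 (q.2.1 - q.1 • q.2.2) q.2.2)))) * eGain B f q with hH
  have hHm : Measurable H :=
    (measurable_const.min ((hFm.comp (measurable_const.prodMk hx)).sub (hFm.comp (measurable_fst.prodMk hx))).neg.exp).ennreal_ofReal.mul
      (measurable_eGain hBm hfm)
  have h1 : ∀ q, ENNReal.ofReal (duhamelMultiplier t C F q) * eGain B f q =
      (Ioo 0 t).indicator (fun _ => (1 : ℝ≥0∞)) q.1 * (C.indicator (fun _ => (1 : ℝ≥0∞)) (q.2.1 - q.1 • q.2.2, q.2.2) * H q) := by
    intro q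
    simp only [hH, duhamelMultiplier]
    by_cases hs : q.1 ∈ Ioo 0 t
    · by_cases hz : (q.2.1 - q.1 • q.2.2, q.2.2) ∈ C
      · simp [indicator_of_mem hs, indicator_of_mem hz]
      · simp [indicator_of_notMem hz]
    · simp [indicator_of_notMem hs]
  simp only [h1]
  rw [← setLIntegral_lintegral_Ioo_sharp_eq hHm hC t]
  refine lintegral_mono fun z => ?_
  rw [eDampedGainPrimitive_apply]
  refine (lintegral_mono_set Ioo_subset_Ioc_self).trans (lintegral_mono fun s => ?_)
  simp only [hH, add_sub_cancel_right]
  rw [mul_comm]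
  refine mul_le_mul' le_rfl (ENNReal.ofReal_le_ofReal (min_le_right _ _))

/-- **The level-truncated Duhamel gain term as a pairing on phase space-time**: for `t > 0`,
`∫_C ∫₀ᵗ 1_{f♯(s) ≤ M} a♯ Q₊(f,f)♯(s) e^{-(Λ♯(t)-Λ♯(s))} ds = ∫ wₖ Mₖ (a Q₊(f,f))` with the level
weight `levelWeight` and the multiplier `duhamelMultiplier t C Λ` (Tonelli and the shear). [cite: CIPDiluteGases1994, §5.3 Step 13 (p. 157)] -/
theorem setLIntegral_levelCut_eq_lintegral {δ' : ℝ} (hδ' : 0 ≤ δ') {Bk : E × E → sphere (0 : E) 1 → ℝ}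
    (hBk : IsDiPernaLionsKernel Bk) {Cb : ℝ} (hCb : ∀ p ω, Bk p ω ≤ Cb) {u : ℝ → E → E → ℝ}
    (hu : IsDiPernaLionsApproximateSolution δ' Bk u) (t : ℝ) {C : Set (E × E)}
    (hC : MeasurableSet C) (M : ℝ) :
    ∫⁻ z in C, (∫⁻ s in Ioc 0 t, (Iic M).indicator (fun _ => (1 : ℝ≥0∞)) (u s (z.1 + s • z.2) z.2) *
        (ENNReal.ofReal ((1 + δ' * ∫ w, |u s (z.1 + s • z.2) w|)⁻¹) * eGain Bk u (s, z.1 + s • z.2, z.2) *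
          ENNReal.ofReal (exp (-(truncatedDampingExponent δ' Bk u t z.1 z.2 -
            truncatedDampingExponent δ' Bk u s z.1 z.2))))) ∂((volume : Measure E).prod volume) =
      ∫⁻ q, ENNReal.ofReal (levelWeight M u q * duhamelMultiplier t C (truncatedDampingExponent δ' Bk u) q) *
        (ENNReal.ofReal ((1 + δ' * ∫ w, |u q.1 q.2.1 w|)⁻¹) * eGain Bk u q) ∂(volume : Measure (ℝ × E × E)) := by
  set Λ : ℝ → E → E → ℝ := truncatedDampingExponent δ' Bk u with hΛ
  have hΛm : Measurable fun a : ℝ × E × E => Λ a.1 a.2.1 a.2.2 := hu.measurable_truncatedDampingExponent hBk.measurable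
  -- the clamped density
  set g : ℝ → E → E → ℝ := fun s x v => u (max s 0) x v with hg
  have hgm : Measurable fun z : ℝ × E × E => g z.1 z.2.1 z.2.2 := by
    have hc : Continuous fun z : ℝ × E × E => ((max z.1 0, z.2) : ℝ × E × E) :=
      (continuous_fst.max continuous_const).prodMk continuous_snd
    exact (hu.continuousOn_uncurry.comp_continuous hc fun z =>
      mk_mem_prod (mem_Ici.2 (le_max_right _ _)) (mem_univ _)).measurable
  have hg_eq : ∀ s, 0 ≤ s → ∀ x v, g s x v = u s x v := fun s hs x v => by simp only [hg, max_eq_left hs]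
  have heG : ∀ q : ℝ × E × E, 0 ≤ q.1 → eGain Bk g q = eGain Bk u q := fun q hq => by
    simp only [eGain, hg_eq q.1 hq]
  have hx : Measurable fun q : ℝ × E × E => (q.2.1 - q.1 • q.2.2, q.2.2) :=
    (measurable_snd.fst.sub (measurable_fst.smul measurable_snd.snd)).prodMk measurable_snd.snd
  -- the integrand in `(s, y, v)` form (clamped)
  set H : ℝ × E × E → ℝ≥0∞ := fun q => (Iic M).indicator (fun _ => (1 : ℝ≥0∞)) (g q.1 q.2.1 q.2.2) *
    (ENNReal.ofReal ((1 + δ' * ∫ w, |g q.1 q.2.1 w|)⁻¹) * eGain Bk g q *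
      ENNReal.ofReal (exp (-(Λ t (q.2.1 - q.1 • q.2.2) q.2.2 - Λ q.1 (q.2.1 - q.1 • q.2.2) q.2.2)))) with hH
  have hHm : Measurable H := by
    refine ((measurable_const.indicator measurableSet_Iic).comp hgm).mul ?_
    refine (((measurable_const.add (measurable_const.mul (measurable_integral_abs_slice hgm))).inv.ennreal_ofReal.comp
      (measurable_fst.prodMk measurable_snd.fst)).mul (measurable_eGain hBk.measurable hgm)).mul ?_
    exact (((hΛm.comp (measurable_const.prodMk hx)).sub (hΛm.comp (measurable_fst.prodMk hx))).neg.exp).ennreal_ofReal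
  -- left side: `Ioc → Ioo`, clamp, Tonelli + shear
  have hL : ∫⁻ z in C, (∫⁻ s in Ioc 0 t, (Iic M).indicator (fun _ => (1 : ℝ≥0∞)) (u s (z.1 + s • z.2) z.2) *
      (ENNReal.ofReal ((1 + δ' * ∫ w, |u s (z.1 + s • z.2) w|)⁻¹) * eGain Bk u (s, z.1 + s • z.2, z.2) *
        ENNReal.ofReal (exp (-(Λ t z.1 z.2 - Λ s z.1 z.2))))) ∂((volume : Measure E).prod volume) =
      ∫⁻ z in C, (∫⁻ s in Ioo 0 t, H (s, z.1 + s • z.2, z.2)) ∂((volume : Measure E).prod volume) := by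
    refine lintegral_congr fun z => ?_
    rw [← restrict_Ioo_eq_restrict_Ioc]
    refine setLIntegral_congr_fun measurableSet_Ioo fun s hs => ?_
    simp only [hH, add_sub_cancel_right, hg_eq s hs.1.le, heG (s, z.1 + s • z.2, z.2) hs.1.le]
  rw [hL, setLIntegral_lintegral_Ioo_sharp_eq hHm hC t]
  -- pointwise identification with the right side
  refine lintegral_congr fun q => ?_
  by_cases hs : q.1 ∈ Ioo 0 t
  · by_cases hz : (q.2.1 - q.1 • q.2.2, q.2.2) ∈ C
    · rw [indicator_of_mem hs, indicator_of_mem hz, one_mul, one_mul]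
      have hmono : Λ q.1 (q.2.1 - q.1 • q.2.2) q.2.2 ≤ Λ t (q.2.1 - q.1 • q.2.2) q.2.2 :=
        hu.truncatedDampingExponent_mono hBk.measurable hBk.nonneg hCb hδ' _ _ hs.1.le hs.2.le
      have hmin : min 1 (exp (-(Λ t (q.2.1 - q.1 • q.2.2) q.2.2 - Λ q.1 (q.2.1 - q.1 • q.2.2) q.2.2))) =
          exp (-(Λ t (q.2.1 - q.1 • q.2.2) q.2.2 - Λ q.1 (q.2.1 - q.1 • q.2.2) q.2.2)) :=
        min_eq_right (by rw [exp_le_one_iff]; linarith)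
      have hdm : duhamelMultiplier t C Λ q = exp (-(Λ t (q.2.1 - q.1 • q.2.2) q.2.2 - Λ q.1 (q.2.1 - q.1 • q.2.2) q.2.2)) := by
        simp only [duhamelMultiplier, indicator_of_mem hs, indicator_of_mem hz, one_mul, hmin]
      have hw : levelWeight M u q = (Iic M).indicator (fun _ => (1 : ℝ)) (g q.1 q.2.1 q.2.2) := by
        simp only [levelWeight, hg]
        by_cases hle : u (max q.1 0) q.2.1 q.2.2 ≤ M
        · rw [if_pos hle, indicator_of_mem (show u (max q.1 0) q.2.1 q.2.2 ∈ Iic M from hle)]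
        · rw [if_neg hle, indicator_of_notMem (show u (max q.1 0) q.2.1 q.2.2 ∉ Iic M from hle)]
      simp only [hH, hdm, hw, hg_eq q.1 hs.1.le, heG q hs.1.le]
      by_cases hle : u q.1 q.2.1 q.2.2 ∈ Iic M
      · rw [indicator_of_mem hle, indicator_of_mem hle]
        simp only [one_mul]
        ring
      · rw [indicator_of_notMem hle, indicator_of_notMem hle, zero_mul, zero_mul, ENNReal.ofReal_zero, zero_mul]
    · have hdm : duhamelMultiplier t C Λ q = 0 := by
        simp only [duhamelMultiplier, indicator_of_notMem hz, zero_mul, mul_zero]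
      rw [indicator_of_notMem hz, zero_mul, mul_zero, hdm, mul_zero, ENNReal.ofReal_zero, zero_mul]
  · have hdm : duhamelMultiplier t C Λ q = 0 := by
      simp only [duhamelMultiplier, indicator_of_notMem hs, zero_mul]
    rw [indicator_of_notMem hs, zero_mul, hdm, mul_zero, ENNReal.ofReal_zero, zero_mul]

/-- **The subsolution inequality on a set of characteristics** (CIP 1994 §5.3 Lemma 5.3.12, display
before (3.44), p. 159: "`f ≤ f₀ e^{-F} + T_F⁻¹ Q₊(f,f)`", here integrated over a measurable set
`C ⊆ E × B̄_{R_v}` of characteristics of finite measure): for `t > 0`,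
`∫_C f♯(t) ≤ ∫_C (f(0) e^{-F♯(t)} + (T_F⁻¹Q₊(f,f))♯(t))`. Proof: the exponential form (3.36) of
`f^{φ(k)}` with the level truncation of its Duhamel gain term
(`lintegral_dampedGain_le_levelCut_add`); the level-truncated term, written as a pairing on phase
space-time (`setLIntegral_levelCut_eq_lintegral`), is bounded in the limit by the upper
semicontinuity of the renormalised gain terms (`IsDiPernaLionsWeakLimit.eventually_lintegral_renormGain_le`)
up to the multiplier error (`eventually_lintegral_levelCut_diff_le`); the data term and the exceptional
set are handled by `eventually_setLIntegral_data_le`, `exists_level_eventually_setLIntegral_exceptional_le`,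
and `∫_C f^{φ(k)}♯(t) → ∫_C f♯(t)` (`tendsto_setLIntegral_sharp`). [cite: CIPDiluteGases1994, §5.3 Lemma 5.3.12, proof, display before (3.44) (p. 159)] -/
theorem IsDiPernaLionsWeakLimit.setLIntegral_sharp_le (hW : IsDiPernaLionsWeakLimit f₀ fseq φ f)
    (hB : IsDiPernaLionsKernel B) (hf₀ : HasDiPernaLionsData f₀) (hδ : ∀ n, 0 < δ n) (hanti : Antitone δ)
    (hlim : Tendsto δ atTop (𝓝 0)) (hker : IsDiPernaLionsKernelApproximation B Bseq)
    (hdata : IsDiPernaLionsDataApproximation f₀ (fun n => fseq n 0))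
    (hsol : ∀ n, IsDiPernaLionsApproximateSolution (δ n) (Bseq n) (fseq n))
    (hbd : UniformDiPernaLionsBounds δ Bseq fseq) {t : ℝ} (ht : 0 < t) {C : Set (E × E)}
    (hC : MeasurableSet C) {Rv : ℝ} (hCsub : C ⊆ univ ×ˢ closedBall (0 : E) Rv)
    (hCfin : ((volume : Measure E).prod volume) C ≠ ∞) :
    ∫⁻ z in C, ENNReal.ofReal (f t (z.1 + t • z.2) z.2) ∂((volume : Measure E).prod volume) ≤
      ∫⁻ z in C, (ENNReal.ofReal (f 0 z.1 z.2 * exp (-(dampingExponent B f t z.1 z.2))) +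
        eDampedGainPrimitive B f t z.1 z.2) ∂((volume : Measure E).prod volume) := by
  set μ : Measure (E × E) := (volume : Measure E).prod volume with hμ
  set F : ℝ → E → E → ℝ := dampingExponent B f with hF
  have hFm : Measurable fun a : ℝ × E × E => F a.1 a.2.1 a.2.2 := measurable_dampingExponent hB.measurable hW.measurable
  refine ENNReal.le_of_forall_pos_le_add fun ε hε _ => ?_
  have hε4 : (0 : ℝ) < (ε : ℝ) / 4 := by positivity
  -- the four eventual bounds
  obtain ⟨M, hM, hexc⟩ := exists_level_eventually_setLIntegral_exceptional_le hB hf₀ hδ hanti hlim hker hdata hsol hbd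
    hW ht.le hC hCsub hCfin hε4
  have hdat := eventually_setLIntegral_data_le hB hf₀ hδ hanti hlim hker hdata hsol hbd hW ht.le (C := C) hCsub hε4
  have hmul := eventually_lintegral_levelCut_diff_le hB hf₀ hδ hanti hlim hker hdata hsol hbd hW ht (C := C) hCsub hM.le hε4
  -- the level weights and the limit multiplier for the upper semicontinuity bound
  set Φ : ℝ × E × E → ℝ := duhamelMultiplier t C F with hΦ
  have hΦm : Measurable Φ := measurable_duhamelMultiplier t hC hFm
  have hΦ01 : ∀ q, 0 ≤ Φ q ∧ Φ q ≤ 1 := fun q => duhamelMultiplier_mem t C F q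
  have hΦs : ∀ q, Φ q ≠ 0 → q ∈ Ioo 0 t ×ˢ (univ ×ˢ closedBall (0 : E) Rv) := by
    intro q hq
    obtain ⟨hs, hz⟩ := mem_of_duhamelMultiplier_ne_zero hq
    exact ⟨hs, mem_univ _, (mem_prod.1 (hCsub hz)).2⟩
  have hgm : ∀ k, Measurable fun z : ℝ × E × E => fseq (φ k) (max z.1 0) z.2.1 z.2.2 := by
    intro k
    have hc : Continuous fun z : ℝ × E × E => ((max z.1 0, z.2) : ℝ × E × E) :=
      (continuous_fst.max continuous_const).prodMk continuous_snd
    exact ((hsol (φ k)).continuousOn_uncurry.comp_continuous hc fun z =>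
      mk_mem_prod (mem_Ici.2 (le_max_right _ _)) (mem_univ _)).measurable
  have hU1 := hW.eventually_lintegral_renormGain_le hB hf₀ hδ hanti hlim hker hdata hsol hbd ht
    (w := fun k => levelWeight M (fseq (φ k))) (fun k => measurable_levelWeight M (hgm k))
    (fun k q => (levelWeight_mem M _ q).1) (fun k q => (levelWeight_mem M _ q).2) hM.le
    (fun k q hq => levelWeight_mul_le hM.le (fseq (φ k)) hq.le) hΦm (fun q => (hΦ01 q).1) zero_le_one
    (fun q => (hΦ01 q).2) hΦs hε4
  -- pass to the limit along the eventual sets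
  refine le_of_tendsto (hW.tendsto_setLIntegral_sharp hsol ht.le hC) ?_
  filter_upwards [hexc, hdat, hmul, hU1] with k h1 h2 h3 h4
  have hsolk := hsol (φ k)
  have hBk := hker.isDiPernaLionsKernel (φ k)
  obtain ⟨Cbk, hCbk⟩ := hker.bounded (φ k)
  obtain ⟨Rbk, hRbk⟩ := hker.eq_zero_of_le (φ k)
  set Λk : ℝ → E → E → ℝ := truncatedDampingExponent (δ (φ k)) (Bseq (φ k)) (fseq (φ k)) with hΛk
  have hΛkm : Measurable fun a : ℝ × E × E => Λk a.1 a.2.1 a.2.2 := hsolk.measurable_truncatedDampingExponent hBk.measurable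
  have hΛkt : Measurable fun z : E × E => Λk t z.1 z.2 := hΛkm.comp (measurable_const.prodMk measurable_id)
  -- (3.36) integrated over `C`
  have hm0 : Measurable fun z : E × E => ENNReal.ofReal (fseq (φ k) 0 z.1 z.2 * exp (-(Λk t z.1 z.2))) :=
    (((hsolk.contDiff_slice 0 le_rfl).continuous.measurable).mul hΛkt.neg.exp).ennreal_ofReal
  have hexp : ∫⁻ z in C, ENNReal.ofReal (fseq (φ k) t (z.1 + t • z.2) z.2) ∂μ =
      (∫⁻ z in C, ENNReal.ofReal (fseq (φ k) 0 z.1 z.2 * exp (-(Λk t z.1 z.2))) ∂μ) +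
      ∫⁻ z in C, (∫⁻ s in Ioc 0 t, ENNReal.ofReal ((1 + δ (φ k) * ∫ w, |fseq (φ k) s (z.1 + s • z.2) w|)⁻¹) *
        eGain (Bseq (φ k)) (fseq (φ k)) (s, z.1 + s • z.2, z.2) *
        ENNReal.ofReal (exp (-(Λk t z.1 z.2 - Λk s z.1 z.2)))) ∂μ := by
    rw [← lintegral_add_left hm0]
    exact lintegral_congr fun z => hsolk.ofReal_sharp_eq_lintegral hBk hCbk hRbk (hδ _).le t ht.le z.1 z.2
  rw [hexp]
  -- the level truncation
  have hcut := hsolk.lintegral_dampedGain_le_levelCut_add hBk hCbk hRbk (hδ _).le t ht.le M C hΛkt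
  have hLC := setLIntegral_levelCut_eq_lintegral (hδ (φ k)).le hBk hCbk hsolk t hC M
  -- the pairing: split the multiplier `Mₖ = Φ + (Mₖ - Φ)`
  have hsplit : ∫⁻ q, ENNReal.ofReal (levelWeight M (fseq (φ k)) q * duhamelMultiplier t C Λk q) *
      (ENNReal.ofReal ((1 + δ (φ k) * ∫ w, |fseq (φ k) q.1 q.2.1 w|)⁻¹) * eGain (Bseq (φ k)) (fseq (φ k)) q)
        ∂(volume : Measure (ℝ × E × E)) ≤
      (∫⁻ q, ENNReal.ofReal (levelWeight M (fseq (φ k)) q * Φ q) *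
        (ENNReal.ofReal ((1 + δ (φ k) * ∫ w, |fseq (φ k) q.1 q.2.1 w|)⁻¹) * eGain (Bseq (φ k)) (fseq (φ k)) q)
          ∂(volume : Measure (ℝ × E × E))) +
      ∫⁻ q, ENNReal.ofReal (levelWeight M (fseq (φ k)) q * (duhamelMultiplier t C Λk q - Φ q)) *
        (ENNReal.ofReal ((1 + δ (φ k) * ∫ w, |fseq (φ k) q.1 q.2.1 w|)⁻¹) * eGain (Bseq (φ k)) (fseq (φ k)) q)
          ∂(volume : Measure (ℝ × E × E)) := by
    rw [← lintegral_add_left' ?_]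
    · refine lintegral_mono fun q => ?_
      rw [← add_mul]
      refine mul_le_mul' ?_ le_rfl
      have : levelWeight M (fseq (φ k)) q * duhamelMultiplier t C Λk q =
          levelWeight M (fseq (φ k)) q * Φ q + levelWeight M (fseq (φ k)) q * (duhamelMultiplier t C Λk q - Φ q) := by ring
      rw [this]
      exact ENNReal.ofReal_add_le
    · -- measurability of the first summand: it agrees everywhere with its clamped version
      have hg_eq : ∀ q : ℝ × E × E, Φ q ≠ 0 → ∀ x v, fseq (φ k) (max q.1 0) x v = fseq (φ k) q.1 x v := by
        intro q hq x v
        rw [max_eq_left (hΦs q hq).1.1.le]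
      have heq : (fun q : ℝ × E × E => ENNReal.ofReal (levelWeight M (fseq (φ k)) q * Φ q) *
          (ENNReal.ofReal ((1 + δ (φ k) * ∫ w, |fseq (φ k) q.1 q.2.1 w|)⁻¹) * eGain (Bseq (φ k)) (fseq (φ k)) q)) =
          fun q => ENNReal.ofReal (levelWeight M (fseq (φ k)) q * Φ q) *
            (ENNReal.ofReal ((1 + δ (φ k) * ∫ w, |fseq (φ k) (max q.1 0) q.2.1 w|)⁻¹) *
              eGain (Bseq (φ k)) (fun s x v => fseq (φ k) (max s 0) x v) q) := by
        funext q
        by_cases hq : Φ q = 0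
        · simp [hq]
        · simp only [hg_eq q hq, eGain]
      rw [heq]
      exact ((((measurable_levelWeight M (hgm k)).mul hΦm).ennreal_ofReal).mul
        (((measurable_const.add (measurable_const.mul (measurable_integral_abs_slice
          (g := fun s x v => fseq (φ k) (max s 0) x v) (hgm k)))).inv.ennreal_ofReal.comp
          (measurable_fst.prodMk measurable_snd.fst)).mul (measurable_eGain (f := fun s x v => fseq (φ k) (max s 0) x v)
          hBk.measurable (hgm k)))).aemeasurable
  have hlimit := lintegral_duhamelMultiplier_eGain_le hB.measurable hW.measurable t hC (f := f)
  -- the right-hand side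
  have hm_rhs : Measurable fun z : E × E => ENNReal.ofReal (f 0 z.1 z.2 * exp (-(F t z.1 z.2))) :=
    ((hW.measurable_slice 0).mul (hFm.comp (measurable_const.prodMk measurable_id)).neg.exp).ennreal_ofReal
  rw [lintegral_add_left hm_rhs]
  -- combine
  have hsum : ENNReal.ofReal ((ε : ℝ) / 4) + ENNReal.ofReal ((ε : ℝ) / 4) + ENNReal.ofReal ((ε : ℝ) / 4) +
      ENNReal.ofReal ((ε : ℝ) / 4) = ε := by
    rw [← ENNReal.ofReal_add hε4.le hε4.le, ← ENNReal.ofReal_add (by positivity) hε4.le,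
      ← ENNReal.ofReal_add (by positivity) hε4.le]
    rw [show (ε : ℝ) / 4 + (ε : ℝ) / 4 + (ε : ℝ) / 4 + (ε : ℝ) / 4 = (ε : ℝ) by ring, ENNReal.ofReal_coe_nnreal]
  calc (∫⁻ z in C, ENNReal.ofReal (fseq (φ k) 0 z.1 z.2 * exp (-(Λk t z.1 z.2))) ∂μ) +
        ∫⁻ z in C, (∫⁻ s in Ioc 0 t, ENNReal.ofReal ((1 + δ (φ k) * ∫ w, |fseq (φ k) s (z.1 + s • z.2) w|)⁻¹) *
          eGain (Bseq (φ k)) (fseq (φ k)) (s, z.1 + s • z.2, z.2) *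
          ENNReal.ofReal (exp (-(Λk t z.1 z.2 - Λk s z.1 z.2)))) ∂μ
      ≤ ((∫⁻ z in C, ENNReal.ofReal (f 0 z.1 z.2 * exp (-(F t z.1 z.2))) ∂μ) + ENNReal.ofReal ((ε : ℝ) / 4)) +
        (((∫⁻ z in C, eDampedGainPrimitive B f t z.1 z.2 ∂μ) + ENNReal.ofReal ((ε : ℝ) / 4) +
          ENNReal.ofReal ((ε : ℝ) / 4)) + ENNReal.ofReal ((ε : ℝ) / 4)) := by
        refine add_le_add h2 (hcut.trans (add_le_add ?_ h1))
        rw [hLC]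
        refine hsplit.trans (add_le_add (h4.trans (add_le_add hlimit le_rfl)) h3)
    _ = (∫⁻ z in C, ENNReal.ofReal (f 0 z.1 z.2 * exp (-(F t z.1 z.2))) ∂μ) +
        (∫⁻ z in C, eDampedGainPrimitive B f t z.1 z.2 ∂μ) + ε := by
        rw [← hsum]; ring

/-- **The DiPerna–Lions weak limit is an exponential subsolution** (CIP 1994 §5.3 Lemma 5.3.12,
proof, display before (3.44), p. 159: "`f ≤ f₀ e^{-F} + T_F⁻¹ Q₊(f,f)`"; in the tree's DiPerna–Lions
generality, through the level truncation of `DiPernaLionsGainLevelTruncation` and the upper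
semicontinuity of the renormalised gain terms of `DiPernaLionsGainUpperBound` instead of CIP's
(3.41)–(3.43)): in the setting of `diPernaLions_extraction`, every weak limit `f` satisfies
`IsExpSubsolution B f`, i.e. for every `t ≥ 0`, a.e. in `(x, v)`,
`f♯(t) ≤ f(0) e^{-F♯(t)} + ∫₀ᵗ Q₊(f,f)♯(s) e^{-(F♯(t)-F♯(s))} ds` in `[0, ∞]`. This is the hypothesis
`hsub` of `diPernaLions_limit_expDuhamel_of`. [cite: CIPDiluteGases1994, §5.3 Lemma 5.3.12, proof, display before (3.44) (p. 159)] -/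
theorem IsDiPernaLionsWeakLimit.isExpSubsolution (hW : IsDiPernaLionsWeakLimit f₀ fseq φ f)
    (hB : IsDiPernaLionsKernel B) (hf₀ : HasDiPernaLionsData f₀) (hδ : ∀ n, 0 < δ n) (hanti : Antitone δ)
    (hlim : Tendsto δ atTop (𝓝 0)) (hker : IsDiPernaLionsKernelApproximation B Bseq)
    (hdata : IsDiPernaLionsDataApproximation f₀ (fun n => fseq n 0))
    (hsol : ∀ n, IsDiPernaLionsApproximateSolution (δ n) (Bseq n) (fseq n))
    (hbd : UniformDiPernaLionsBounds δ Bseq fseq) : IsExpSubsolution B f := by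
  intro t ht
  rcases ht.lt_or_eq with ht | ht
  swap
  · -- `t = 0`
    subst ht
    refine ae_of_all _ fun z => ?_
    rw [alongFreeFlow_zero, dampingExponent_zero, neg_zero, exp_zero, mul_one]
    exact le_self_add
  set μ : Measure (E × E) := (volume : Measure E).prod volume with hμ
  set u : E × E → ℝ≥0∞ := fun z => ENNReal.ofReal (f t (z.1 + t • z.2) z.2) with hu
  set w : E × E → ℝ≥0∞ := fun z => ENNReal.ofReal (f 0 z.1 z.2 * exp (-(dampingExponent B f t z.1 z.2))) +
    eDampedGainPrimitive B f t z.1 z.2 with hw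
  have hum : Measurable u := ((hW.measurable_slice t).comp ((measurable_fst.add (measurable_snd.const_smul t)).prodMk
    measurable_snd)).ennreal_ofReal
  -- it suffices to compare on `E × B̄_n` for every `n`
  suffices h : ∀ n : ℕ, ∀ᵐ z ∂(μ.restrict (univ ×ˢ closedBall (0 : E) n)), u z ≤ w z by
    have hcover : (univ : Set (E × E)) ⊆ ⋃ n : ℕ, (univ : Set E) ×ˢ closedBall (0 : E) n := by
      intro z _
      obtain ⟨n, hn⟩ := exists_nat_ge ‖z.2‖
      exact mem_iUnion.2 ⟨n, mem_univ _, mem_closedBall_zero_iff.2 hn⟩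
    have h' : ∀ᵐ z ∂(μ.restrict (⋃ n : ℕ, (univ : Set E) ×ˢ closedBall (0 : E) n)), u z ≤ w z :=
      (ae_restrict_iUnion_iff _ _).2 h
    have h'' : ∀ᵐ z ∂μ, u z ≤ w z := by
      have := ae_restrict_of_ae_restrict_of_subset hcover h'
      rwa [Measure.restrict_univ] at this
    simpa only [hu, hw, alongFreeFlow_apply] using h''
  intro n
  haveI : SigmaFinite (μ.restrict ((univ : Set E) ×ˢ closedBall (0 : E) n)) := by rw [hμ]; infer_instance
  refine ae_le_of_forall_setLIntegral_le_of_sigmaFinite hum fun s hs hμs => ?_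
  rw [Measure.restrict_restrict hs]
  have hsub : s ∩ (univ : Set E) ×ˢ closedBall (0 : E) n ⊆ (univ : Set E) ×ˢ closedBall (0 : E) (n : ℝ) :=
    inter_subset_right
  have hfin : μ (s ∩ (univ : Set E) ×ˢ closedBall (0 : E) n) ≠ ∞ := by
    rw [Measure.restrict_apply hs] at hμs
    exact hμs.ne
  exact hW.setLIntegral_sharp_le hB hf₀ hδ hanti hlim hker hdata hsol hbd ht (hs.inter
    (MeasurableSet.univ.prod measurableSet_closedBall)) hsub hfin


end Subsolution

end Literature.MathematicalPhysics.KineticTheory
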